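import Summits.BirchSwinnertonDyer.BirchSwinnertonDyer.Theses.ErratumRoadFive
import Literature.NumberTheory.EllipticCurves.Kato2004.AdmissibleZetaClassRealisability
import Literature.NumberTheory.EllipticCurves.Kato2004.AdmissibleZetaClassLengthInequality
import Literature.NumberTheory.EllipticCurves.Kato2004.IwasawaH2FineSelmerDualCountRankFree
import Literature.NumberTheory.EllipticCurves.MordellWeilTheoremProofs
import Literature.NumberTheory.EllipticCurves.TateModuleContinuityProofs
import Literature.NumberTheory.EllipticCurves.LeadingTerm
import Literature.NumberTheory.EllipticCurves.Rank1Residual.Typed.Basic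
import Literature.NumberTheory.EllipticCurves.CongruenceNumber
import Literature.NumberTheory.EllipticCurves.GrossZagierRationalPointProofs
import Literature.NumberTheory.EllipticCurves.Castella2018.PAdicWaldspurgerFormula
import Summits.BirchSwinnertonDyer.Rank1Residual.X11b.AnticyclotomicEmbedding
import Summits.BirchSwinnertonDyer.Rank1Residual.X11b.HalvesReceptacle
import Summits.BirchSwinnertonDyer.Rank1Residual.X11b.RouteR1BDPValue
import Literature.NumberTheory.EllipticCurves.ZpExtensionAnticyclotomicHoldsProofs
import Literature.NumberTheory.EllipticCurves.UnrIntegersUnits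
import Literature.NumberTheory.EllipticCurves.PastenSpectralDegreeProofs
import Literature.NumberTheory.EllipticCurves.NeronIsogenyScalingHoldsProofs
import Summits.BirchSwinnertonDyer.Rank1Residual.X11b.BDPRouteManin
import Literature.FieldTheory.AlgClosed.PadicAlgClEquivComplex
import Literature.NumberTheory.EllipticCurves.KrausOesterle1992.TorsionCongruenceCriterionHasseWeilProofs
import Summits.BirchSwinnertonDyer.BirchSwinnertonDyer.Theorems.CongruentShaFreeCutKatoKummerLogTorsion
import Literature.NumberTheory.QuadraticFields.ImaginaryResiduePiForm
import Summits.BirchSwinnertonDyer.BirchSwinnertonDyer.Theorems.ErratumRoadFiveGrossZagierDescentExact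
import Summits.BirchSwinnertonDyer.BirchSwinnertonDyer.Theorems.ErratumRoadFiveKatoFframeValueAtoms
import Summits.BirchSwinnertonDyer.BirchSwinnertonDyer.Theorems.ErratumRoadFiveKatoFframeValueAtomsOfFamily
import Summits.BirchSwinnertonDyer.BirchSwinnertonDyer.Theorems.ErratumRoadFiveValueByNormContinuity
import Literature.NumberTheory.EllipticCurves.BDPValueContinuityMultiplicativePrime
import Summits.BirchSwinnertonDyer.BirchSwinnertonDyer.Theorems.ErratumRoadFiveOpenInputNotRamBDPFrameDescentStub
import Literature.NumberTheory.EllipticCurves.StrictSelmerRankOneDegreeOneProofs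
import Literature.NumberTheory.EllipticCurves.NewformGaloisRep
import Literature.NumberTheory.GaloisRepresentations.ResidualGaloisRep
import HarnessLib

/-!
# Deliverable (622)(1) — the NEWFORM-SHAPED calibrator `S2-NF` for the BDV-calibration split of `A♭-fam`

Crux of record: `ErratumRoadFive.EulerHalfNotRamNoInertSetAtFive` (stmt-BirchSwinnertonDyer-19715); serves the
ER5 aside `KatoValuationIneqNonsplitAtFive` (stmt-…-33169), line of record `Cruxes/KatoValuationIneqNonsplitAtFive/
Lines/bstw_door.lean` (sha16 `5666110a8ff7d20b`, stub `stub_katoBdpCrossingNonsplitFamily` = `A♭-fam`, l.781–833).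
Seat bsd-idea-9 g49 (lens = complete; W-71/W-79: `ledger crux write` only, no route birth, no skeleton check, kit 0).
rev 1.2 (bsd-idea-9 g51, 2026-08-31): S1-NF ON THE R CURVE CONJUNCT (`…R` decls, pen g52 (α) = S1R) and THE NF CHAIN'S OWN
INDEX NAMED (BSTW's `Γ₁(N_g)`-congruence number `c̃_g`, datum field `congrIdx`; port pinned to BSTW's literal pair) — §H.
rev 1.2.1 (g51, 2026-08-31): critic V381 PASS (5 notes) — N1–N4 paid in §H (H5); docstrings only, Lean bodies = rev 1.2.
Director-bsd g23 ruling (622) 2026-08-30T17:14:22Z: «(b′) S2-NF IS THE LINE'S S2; (b) [the curve-shaped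
`EisensteinPeriodRatioValuation`, deliverable 1 `Lines/bdv_calibration_split.lean` 32d3c462f2f9] stays the registered
stub text until r2; (c) BDPo «V ≡ 0» is the FALLBACK».  THIS FILE = the S2-NF typing sketch asked for in (622)(1):
D1–D5 as elaborating `def`s, the S2-NF binder, the list of curve-typed decls that need newform twins (module
docstring §C and memo `Lines/bdv22_S2NF_typing.md`), and the S1 V-uniformity question answered (§D: YES).

NOTHING in this file proves a summit statement; BSD is proved for no curve here.  The file is `sorry`-free; its one
theorem-with-content is the RECOMPOSITION `aFlatFamR_of_bdvChainNFR_of_calibrationNF :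
BdvChainExplicitNFR P → (∀ p ≥ 5, ∀ admissible L, EisensteinPeriodRatioValuationNF P L p) → AFlatFamStatementR`
(conclusion = the registered stub statement, copied token for token from deliverable 1 l.605–656, whose identity with
bstw_door.lean l.782–832 @referee g87 certified 2026-08-30T17:10:45Z: raw-span sha16 3129208a824270e1).

## A. Currency decision (why S2-NF is SHORTER than S2)

BSTW work in the newform's OPTIMAL currency [BSTW24 = arXiv:2409.01350v1, §1.2 p.13 L40–p.14 L160: good `ω ∈ S_{g,O}`,
`O`-bases `γ_g^± = δ_g^±/c̃_g` of `T^±_{O,g}` [Lemma 1.5 (ii) p.15 L21–31; rev 1.1 wrote «`γ^± = δ_g^±`» — e10, corrected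
§H], optimal periods `Ω^±`, Rem. 1.3 p.14 L133: «for the newform of an elliptic curve
the optimal periods are a `ℤ_(p)`-basis of the Néron periods»].  In that currency the three CONVERSION terms of the
registered curve exponent `bdvExplicitExponent` — Manin `ord_p c`, the lattice index `ord_p k`, and
`Γ₀ = ord_p r_f − ord_p m_f` — are ABSENT, and `perRatio = 1` — under the PORT PINNING fixed in §H (rev 1.2: not «identically»; the NF chain's own
index, BSTW's `Γ₁(N)`-congruence number `c̃_g`, sits in the class normalisation and is NAMED there).  What is left of the exponent is read off
BSTW (log-Kato-elt-1) [p.60 L17–24] ∘ (GRL=logheegner)(i) [p.60 L8–12] ∘ BDP: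
`‖X′‖ = p · ‖p + 1 − a_p(g)‖_λ · ‖s′‖_λ · ‖σ′‖ / ‖q′ · R′ · ∏_{ℓ ∣ A, ℓ ≠ p} E′_ℓ‖_λ`      (NF crossing identity, NORM FORM)
with `√|d_L| · L(g ⊗ χ_L, 1) = s′ · Ω⁻` (`‖𝔤(χ_L)‖_λ = 1` as `p ∤ d_L`), `σ′ = log_BK^{η_ω}(loc_p z)` for the bottom class
`z` of a Kato family pinned by the VALUE LAW in `(Ω⁺, Ω⁻)`-currency with constant `q′` and auxiliary cusp data
`(c, d₁, a, A, d′)` (so `σ′` differs from BSTW's `log_BK(loc_p z_Kato(g))` by `q′ R′ ∏ E′_ℓ`, exactly as `σ` differs on the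
curve side by `q R ∏ P_ℓ / perRatio`), and `u_L, c(ω,γ,γ′) ∈ O_λ^×` [p.60 L76–96 (`u_L ∈ ℤ_(p)^×`); Prop. (ERLIint)].
COEFFICIENTS: `ℚ̄_p`-currency of the tree — the place `λ ∣ p` of the Hecke field is the one induced by the frame's
`ι′ : PadicAlgCl p ≃+* ℂ`, `‖·‖_λ := ‖ι′⁻¹(·)‖` on `PadicAlgCl p` (Mathlib spectral norm; handles ramified `λ` with no
bookkeeping), so NO valuation twin (D5) and NO coefficient-field binder is needed: D5 = `‖ι′.symm ·‖`.

## B. The D-twins (all ELABORATE; D1 is a CITATION, D3 is the ONE posited interface)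

* D1 (Galois lattice ↔ `tateRep W p`): CITED, not restated — `IsGaloisRepOfNewform1 (liftToGamma1 N 2 g) ι_λ {ℓ ∣ Np} ρ`
  (`NewformGaloisRep.lean`) for `ρ : FramedGaloisRep ℚ (PadicAlgCl p) 2`, `ι_λ = ι′⁻¹ ∘ (K_g ⊂ ℂ)`; arithmetic-Frobenius
  charpoly `X² − a_ℓ X + ℓ` = the Tate-module (homological, `V_g(1)`) normalisation of `tateRep`; residual irreducibility
  `ρ.IsResiduallyAbsIrreducible` (`ResidualGaloisRep.lean`) twins `Irr W p`/`Surj W p`.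
* D2 (Kato family ↔ `ZetaBody W p f …`): `ZetaBodyNF` below = `ZetaBody` transcribed clause by clause (C1–C5) over
  `T := ρ.toGaloisRep` (generic `IsEulerSystem`/`H1`/`resLe`/`conjMap` of `EulerSystem.lean`), value datum
  `Λ_{k,r} : H¹ → ℚ̄_p ⊗_ℚ ℚ(ζ_m)`, periods `(Ω⁺, Ω⁻)` as PARAMETERS pinned by `IsOptimalPeriodPair` (D2p), cusp factor
  `cuspFactorNF` (D2c: symbols `plusSymbol g r / Ω⁺`, `minusSymbol g r / Ω⁻` instead of the RATIONAL `ratPlusSymbol f`),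
  Euler factor `eulerFactorAtOneNF` (D2e: `cuspCoeff g ℓ` instead of `W.LFunction ℓ`).  [Kato04 Thm. 12.5 is stated for
  general newforms with coefficients; (8.1.3), Prop. 8.12, Thm. 9.7, Thm. 6.6 (1) likewise.]
* D3 (Bloch–Kato/Kummer log ↔ `HasLocPKummerLog W p x σ`): the tree's version is the FORMAL-GROUP log of `W` at `p`;
  a newform has no curve, so `log_BK^{η_ω} ∘ loc_p` on `H¹(ℚ(μ_m), V_g(1))` [BSTW §1.2.10–1.2.12 p.16–18 (Coleman map,
  `η_ω`)] is posited as the single field `NFPort.HasBKLog` of an INTERFACE `NFPort` (a `structure`, never an instance,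
  never an axiom): every statement below takes `(P : NFPort)`; the CONSTRUCTION «the intended `P` exists» is port debt
  for the typer (Literature module on `D_dR`/`exp_BK` for `V_g`), stated separately, never smuggled.
* D4 (Heegner side ↔ `ModularParametrizationData`/`heegnerPointComplex`/`Dt.c`/`modularDegree`/`congruenceNumber`):
  ABSENT in optimal currency — the BDP value `X′` is read through the form-typed `IsBDPLFunction ι′ 𝔭 κ γ′ g ΩK Ωp Λg`
  (already newform-level in the tree) and BSTW's (GRL=logheegner) carries `log_{ω_g} y_L` internally.
* D5 (valuations ↔ `padicValRat`/`σ.valuation`): `‖ι′.symm ·‖` (§A).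

## C. Curve-typed decls of the registered frame and their newform twins (decl ↦ twin)

`tateRep W p` ↦ `ρ.toGaloisRep` + `IsGaloisRepOfNewform1` (cite) · `Irr W p`, `Surj W p` ↦ `ρ.IsResiduallyAbsIrreducible` ·
`GoodOrd W p` ↦ `¬ p ∣ 2N ∧ ‖ι′⁻¹ a_p(g)‖ = 1` · `W.analyticRank = 1` ↦ `∃ Λ ∈ completedCuspFormLContinuations N g,
analyticOrderNatAt Λ 1 = 1` · `(W.quadraticTwist d_L).entireLFunction 1 ≠ 0` ↦ `∃` entire continuation of
`twistedLSeries g χ_L` non-vanishing at `1`, `χ_L` pinned by `jacobiSym d_L` (tree idiom) · `ZetaBody` ↦ `ZetaBodyNF` ·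
`ratCuspFactor f`/`cuspFactor f` ↦ `cuspFactorNF` · `eulerFactorAtOne W` ↦ `eulerFactorAtOneNF` · `plusPeriod f`,
`minusPeriod f`, `perRatio`, `W.realPeriodRat`, `W.imaginaryPeriodRat` ↦ `IsOptimalPeriodPair g ι′ Ω⁺ Ω⁻` ·
`IwasawaH1Data`/`levelToLayer`/`bottomClass`/`y` ↦ NOT NEEDED (the bottom class is the level-`(0, ∅)` member `z 0 1` of
the family itself; the Iwasawa detour exists on the curve side for the main-conjecture currency of the LEAD, not for the
crossing identity) · `HasLocPKummerLog W p` ↦ `P.HasBKLog` (D3, posited) · `ModularParametrizationData`, `HeegnerDatum`,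
`heegnerPointComplex`, `Dt.c`, `modularDegree`, `congruenceNumber`, `s`, `k` ↦ ABSENT except `s′` (§A) ·
`IsBDPLFunction … Dt.f …`, `Λf.HasValueAt 0 X`, `X11b.primeOfEmbeddingDatum` ↦ THEMSELVES (form- or `L`-typed already) ·
`padicVal*`, `σ.valuation` ↦ norms `‖ι′.symm ·‖`, `‖σ′‖`.

## D. Q3 — must S1's `V` be uniform over curve targets AND newform calibrators?  YES.

The glue consumes S1 AT THE CALIBRATOR (to pin `V p d_L = 0`) and AT THE TARGET (to conclude); the printed supply
(BSTW Prop. 4.23 p.45 L48–64, §8.2 p.66 L43–66, Lemma 8.2) yields CM newforms `g_ψ`, so `BdvChainExplicitNF` quantifies ONE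
`V : ℕ → ℤ → ℤ` over {rational non-exceptional rank-one curves} ∪ {`NFCalibratorDatum`s}.  This is BDV's own move:
[BDV22 §4.6 p.44 L13–15] the constant of (38) «depends on `(K,p)` but not on `f`», and the proof of Lemma 4.6
[p.44 L33–67, p.45 L1–46] APPLIES (38) to the CM theta series `f_{χ_D}` of level `D²` with the same constant; BSTW's
`u_L` is pinned the same way [p.60 L86–96: «`u_L ∈ ⋂_{ψ∈𝔛} F_ψ = ℚ`»].  The uniformity is definitional once both members
are read in the SAME canonical (optimal) normalisation — for curves this is Rem. 1.3 [BSTW p.14 L133].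
Kill criterion of (622) for (b′) («a D1–D5 port that needs a curve-side hypothesis not in BSTW»): NOT TRIGGERED on the
print side — every clause of `NFCalibratorDatum` is newform-level in BSTW Thm. 6.4/§6.2.1 and Kato 2004; the one
non-printed input is the realisation of D3 (`NFPort`), which is curve-free by construction.

## E. Degeneracy caveat (honest)

Over an ARBITRARY `P : NFPort` the statements are schematic: `EisensteinPeriodRatioValuationNF P L p` has content
exactly when `P.HasBKLog` is the intended Bloch–Kato logarithm; for junk `P` (e.g. `HasBKLog := ⊤`) S2-NF degenerates
and S1-NF's newform conjunct becomes false or vacuous accordingly.  The recomposition theorem is proved UNIFORMLY in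
`P`, so nothing false is asserted; the typer's port replaces `P` by the constructed instance.  4c-checklist: (ii) no
Bochner integrals; (iv) no hand-picked thresholds (the shift is `∃ V`); quantifier order as on the curve side.

## F. Critic idea-crit-14 V359 N1 / A214 O1–O3 (2026-08-30T17:24–17:26Z) — answered in the typing

N1 («S1's class must CONTAIN the calibrators»): `BdvChainExplicitNF P := ∃ V, BdvChainCurveConjunct V ∧ BdvChainNFConjunct P V`
— ONE `V` bound once outside both conjuncts; the glue uses the NF conjunct at the calibrator and the curve conjunct at the
target (§D).  O1 (`p` split in `L` throughout BSTW §4–§6): carried by the OUTER binder `SatisfiesHeegnerHypothesis p L` of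
both S1-NF and S2-NF (as registered), not restated inside the datum.  O2 (Lemma 8.2 needs `L ∉ {ℚ(i), ℚ(√−2)}`): implied by
the registered outer binders `NumberField.discr L < −4 ∧ Odd (NumberField.discr L)` (`d_L ∉ {−4, −8}`), so `u_L ∈ ℤ_(p)^×`
[BSTW p.60 L86–96] is available for every caller's `L`.  O3 (the four `F^×`-constants of (log-Kato-elt-1)): `L(1,g′)/Ω⁻` is
CARRIED EXPLICITLY as `‖s′‖_λ` in `NFCalibratorDatum.rhs` (`√|d_L|·L(g⊗χ_L,1) = s′·Ω⁻`, field `hs'`) — it is the newform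
twin of the descent scalar `s` and is NOT hidden in the calibrated constant; `c(ω,γ,γ′) ∈ O_λ^×` at `p ∤ N` [Prop. 4.13 (ii)]
and `‖𝔤(χ_L)‖_λ = 1` (`p ∤ d_L`) are units; `c_g` (`φ_A^* ω_A = c_g ω_g`) does NOT occur because the identity is read on
`J₀(N)`/the newform [first form of (log-Kato-elt-1), p.60 L17–24], never on a quotient `A` — and the curve side's `k`
(`c·Ω⁻_f = k·Ω⁻_E`) and Manin `c` have no twin because `Ω⁻` IS the optimal period (§A).  The Kato-side normalisation
constant `q′` and cusp/Euler data `R′`, `E′_ℓ` are carried explicitly in `rhs` exactly as `q`, `R`, `P_ℓ` are on the curve side.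

## G. rev 1.1 — critic V361 (2026-08-30T18:06Z, PASS-WITH-PRICE): P-NF1 paid, C1/C2 carried

P-NF1 (POLARITY OF THE PORT).  `P : NFPort` as a free parameter is sound for the GLUE (`AFlatFamStatement` does not mention
`P`) but NOT for registered items: with the junk port `P₀ := ⟨fun … ↦ True⟩` the field `σ` is free in every datum, so
`∀ P, BdvChainExplicitNF P` is refutable modulo supply and `EisensteinPeriodRatioValuationNF P₀ L p` is vacuous-true modulo
supply.  The REGISTRABLE texts are therefore the `∃ P`-BUNDLED ones of §5 below — `BdvCalibrationNF := ∃ P, S1-NF P ∧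
(∀ p ≥ 5 ∀ adm L, S2-NF P L p)` (ONE `P` shared by S1-NF and S2-NF, the same polarity lesson as the single `V`) and its
three-piece variant `BdvCalibrationPiecesNF` — each with a proved glue to `AFlatFamStatement`; or `P` pinned to a named
constructed predicate once the tree has `D_dR`/`exp_BK`.  Never `variable (P : NFPort)` + per-statement stubs.
C1 (WHERE THE CONTENT SITS).  Given S2c-NF and supply at every admissible `(p, d_L)`, S1-NF forces `V ≡ 0` there, so the
line's research content is the VALUATION-currency `f`-blindness of BDV's explicit scalar — see the sharpened «Why it might
fail» of `BdvChainExplicitNF` and the falsifier T0 in the memo.  C2: see the docstring of `CalibratorSupplyNF`.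

## H. rev 1.2 (g51, 2026-08-31) — S1-NF ON THE R CURVE CONJUNCT; THE NF CHAIN'S OWN INDEX NAMED

Asked by pen g52 (`pub/bsd-stepL/STATUS.md` 2026-08-31T03:03:23Z: repair (α) = S1R CHOSEN, TOTIENT spelling; d2R P2 gated on
this rev) and critic idea-crit-14 V379 (NF note).  Inputs: memo `Lines/bdv22_o4_erho_level.md` rev 1.4 (A6)/(A7); typer
ty-snf g1 T0′ memo (`pub/bsd-stepL/ty-snf/g1/T0PRIME-MEMO.md`, Q1–Q4); S1R sketch `Lines/bdv_explicit_exponent_R_Sketch.lean`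
rev 1.2.  Every BSTW locator below is arXiv:2409.01350v1 as materialised (`pNNNN.txt:L`).

(H1) R CURVE CONJUNCT.  `BdvChainCurveConjunctR V`, `AFlatFamStatementR`, `BdvChainExplicitNFR P` (and the bundled
`BdvCalibrationNFR`, `BdvCalibrationPiecesNFR`) = the rev 1.1 texts with the ONE amendment of S1R in the pen's TOTIENT spelling:
exponent `bdvExplicitExponentR … v N := bdvExplicitExponent … v − v_p(φ(N))`, `N` the level binder of `f : CuspForm (Gamma0 N) 2`
(`IsNewformOf W f`, so `N = N_W`; `p ∥ N_W` and `p ∤ p − 1` give `v_p φ(N_W) = v_p φ(N_W/p) = v_p ι_{N_W/p}`), written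
`− (padicValNat p (Nat.totient N) : ℤ)` right after the KEPT Γ₀ pair `(congruenceNumber Dt.f, D.modularDegree)`; zero new
notions; on `p ∤ φ(N)` it IS the rev 1.1 exponent (`bdvExplicitExponentR_eq_of_not_dvd_totient`).  Reason (typer T0′ = memo rev
1.4): BDV's unit `A` carries KLZ's `Γ₁(N_f)`-Petersson, booked nowhere else in print or frame.  All glue is re-proved on R
(`aFlatFamR_of_…`).  The LEAD's `Theorems/ErratumRoadFiveBdvCalibrationSplitR.lean` (d2R P1) is the decl of record for
`AFlatFamStatementR`/`BdvChainExplicitNonsplitR` once landed; the copies here serve the NF port (P2) and must then agree token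
for token (the pen keys 33169 r3 once, after P1 + P2).

(H2) THE NF CHAIN'S OWN INDEX — NAMED.  It is BSTW's `Γ₁(N_g)`-CONGRUENCE NUMBER `c̃_g` [(congruence) p.15 L43:
`c_g·O = φ_{Γ₁(N),O}(Ann_𝕋(𝔭_g))·O`], and it is NOT «identically absent» (rev 1.1 §A, §F O3, S2-NF docstring — the same currency
slip as memo e9, logged e10 below): BSTW's `O`-bases of `T^±_{O,g}` are `γ_g^± = δ_g^±/c̃_g` [Lemma 1.5 (ii) p.15 L21–31], and a
GOOD differential is an `O`-basis of the QUOTIENT lattice `S_O` [def. p.14 L60–77], i.e. `ω_g/c̃_g` up to `O^×` [Lemma 1.5 (i)],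
not `ω_g`.  BSTW's PRINTED PAIR: the class `z_Kato(g)` of (log-Kato-elt-1) is the specialisation of `𝐳_γ(g)` [p.59 L20–25] for
the `γ` CHOSEN at p.60 L4–5 («`γ^±` an `O`-basis of `T^±_{O,g}`»), i.e. `𝐳_{γ_g} = 𝐳_{δ_g}/c̃_g` (`𝐳_γ` is `F_λ`-linear in
`γ`, §1.2.9 p.22); the logarithm is `log_BK^{η_{ω_g}}` along the FIXED newform differential `ω_g ↔ 2πi·g(z)dz` [p.60 L36–44,
with `log_{ω_g}(y_L)` on the right; `η_ω` is defined by `φ(η_ω) = α η_ω`, `[ω, η_ω] = 1`, p.17 L69–70, so `η_{ω/c} = c·η_ω` and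
`log^{η_{ω/c}} = c⁻¹·log^{η_ω}`].  Write the NF datum's value functional `Λ` (D2, (C4)) as «`exp*` read in the coordinate of a
differential `ω_Λ`» and its `HasBKLog` (D3) as «along `η_{ω_log}`».  The value law (C5) pins `Λ(z) = q′·L/Ω_opt·R′`, and
`exp*(𝐳_γ) = (L/Ω⁺_{ω,γ})·ω` for every `ω` [periods `Ω^±_{ω,γ}`: p.14 L96–121; `Ω_{ω/c,γ} = Ω_{ω,γ}/c`, `Ω_{ω,γ/c} = c·Ω_{ω,γ}`,
whence `Ω_{ω_g/c̃_g, γ_g} = Ω_{ω_g, δ_g} = Ω_opt`], so the pinned bottom class is `q′·𝐳_{γ_g}` if `ω_Λ` is good and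
`q′·𝐳_{δ_g} = q′·c̃_g·𝐳_{γ_g}` if `ω_Λ = ω_g`.  Therefore
    `σ′ = c̃_g^m · σ_BSTW · (q′R′∏E′_ℓ-conversion)`,    `m(port) = a − b ∈ {−1, 0, +1}`,
    `a = 1` iff `ω_Λ = ω_g` (`a = 0` iff `ω_Λ` good),    `b = 1` iff `ω_log` good (`b = 0` iff `ω_log = ω_g`, AS PRINTED),
and the exact NF crossing identity is `‖X′‖ = rhs · ‖c̃_g‖_λ^{−m}` with `rhs` as typed (`‖c̃_g‖_λ := ‖ι′⁻¹ c̃_g‖ ≤ 1`).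
rev 1.1 was INCONSISTENT: its `rhs` is exact iff `m = 0`, while its D2 docstring («`exp*` read through a good `ω`», `a = 0`) and
its D3 docstring («`log_BK^{η_ω}` for SOME good `ω`», `b = 1`) declare `m = −1`.
rev 1.2 DECISION — the port is PINNED to BSTW's literal pair `(a, b) = (0, 0)`, `m = 0`: D2's `Λ` reads `exp*` in the coordinate
of the GOOD differential `ω_g/c̃_g` (kept; so the pinned bottom class is `q′·𝐳_{γ_g}`, BSTW's own) and D3's `HasBKLog` is
`log_BK^{η_{ω_g}}` along the FIXED `ω_g` (CHANGED from «some good `ω`»).  Under this pinning `c̃_g` is ABSENT FROM `rhs` — by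
pinning, not identically: it is PRESENT in the class normalisation, and constructing `Λ` requires it (the good differential is
`ω_g/c̃_g`), so it is NAMED in Lean — `NFPort.IsCongruenceGenerator` (posited second interface field; construction = port
obligation; BSTW (congruence), (cong-formula) p.15 L43–56) and the datum fields `congrIdx`, `congrIdx_spec`, `congrIdx_ne`.  The
`c̃`-free CANONICAL alternative `(a, b) = (1, 0)` (both along `ω_g` — the twin of the curve side's Néron/`ω_E` reading) has
`m = +1` and exact right-hand side `NFCalibratorDatum.rhsCanonical D = D.rhs / ‖D.congrIdx‖` (`= D.rhs` when `‖c̃_g‖_λ = 1`: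
`rhsCanonical_eq_rhs_of_norm_eq_one`); a port choosing it swaps `rhs` for `rhsCanonical` in S1-NF/S2-NF/S2c-NF — every glue
theorem below is insensitive to the swap (they use the identities only as equations between `‖X′‖` and a non-zero real).
SAME TABLE, CURVE COLUMN (consistency with T0′): the registered frame pins the curve class in Néron `ω_W`-VALUE currency
(`HasLocPKummerLog` = formal-group logarithm along `ω_W = c·ω_f`, Manin `c` booked as `ord_p c`; `plusPeriod f = perRatio·Ω_W⁺`):
`(a, b) = (1, 0)`, `m = +1` — the curve column carries `c̃^{Γ₁}(f_W)` ONCE, and at a good-image `p ∥ N_W`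
`c̃^{Γ₁}(f_W) ∼_p ι_{N_W/p} · m_W^{X₀}` [(Γ₁-ARS) dictionary of the memo: Tilouine 1997 Thm 3.4 + Cor., ARS12 Thm 2.1, Mazur78;
BSTW Rem. 1.7 p.15 L57–60 at `p ∤ 2N`] = T0's booked Petersson→Néron `m`-row + S1R's `v_p φ(N)` — exactly (H1).  So in the
calibration `Δ = (a) − (b)` each column books its own Γ₁ congruence number with its own multiplicity — curve `+1` (rows `m`, `ι`),
NF `0` (pinning) — and «one `V`» (§D) is unaffected: BDV's (38) for a newform member `g`, re-expressed in the `(0,0)` currency,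
books `+(ι_{N_g} + m_g)` (its `A_g`-row and its Petersson→period row) and `−c̃_g` (class conversion `𝐳_{δ_g} ↦ 𝐳_{γ_g}`), net
`0` by Rem. 1.7 — consistent with S2c-NF's exactness and `V ≡ 0`.
(H3) BY-HYPOTHESIS VARIANT (recorded, NOT adopted as a field): if `λ ∤ c̃_g` the four pinnings agree and `rhs = rhsCanonical`.
For a RATIONAL calibrator this is typable today as `¬ p ∣ Nat.totient N ∧ ¬ p ∣ congruenceNumber g` (no Dirichlet character
mod `N` of `p`-power order ⇒ `𝕋_{Γ₁(N),𝔪} = 𝕋_{Γ₀(N),𝔪}`; tree `congruenceNumber` = ARS `r_g`, meaningful for integral `g` only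
— docstring of `CongruenceNumber.congruenceNumber`); but S2a-NF's printed supply (`g_ψ`, CM) is non-rational in general and the
general notion (ARS12 §3, `S₂(ℤ)[I_g]`) is not in the tree — left to the supply seat (C2) as an optional convenience.
(H4) NOT claimed here: the `m`-row inside T0's `𝔇` (F1′(b), research seat); BSV21b/MTT86 normalisations (c3, c6; acq-14925,
acq-00040).  Both conventions for `log^{η}` (coefficient along `η_ω`; pairing with `ω`) scale as `c⁻¹` under `ω ↦ ω/c`, so
the sign of `b` is convention-free.  Desk test for the critic: BSTW's own Thm. 6.4 at a rational `g = f_E` with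
`p ∤ 2N·m_E·φ(N)`: all pinnings coincide, `‖c̃_g‖_λ = 1`, and (log-Kato-elt-1) is `‖X′‖ = rhs` verbatim.
(H5) critic V381 (PASS) notes, paid rev 1.2.1.  N1: `bdvExplicitExponentR` has TWO sketch copies (here, inline; S1R sketch rev 1.3,
now the SAME inline body + `bdvExplicitExponentR_eq_sub`) — the TREE gets ONE definition, the LEAD's er5 F1 (`…BdvCalibrationSplitR`/RDefs);
the d2R P2 port IMPORTS F1 and does NOT port this namespace's local copy.  N2 (convention of `b` PINNED): «along `η_ω`» := the
`η_ω`-COORDINATE of `log_BK x` in the basis `(ω, η_ω)` of `D_dR` modulo `Fil⁰ = F_λ·ω` (equivalently `±[log_BK x, ω]`, well-defined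
because `Fil¹` is isotropic); both readings scale as `c⁻¹` under `ω ↦ ω/c` (`η_{ω/c} = c·η_ω`), so `b`'s sign is as in (H2); a pairing
against `η_ω` itself is NOT well-defined on `D_dR/Fil⁰` and is not meant.  N3: the `(0,0)` PORT PINNING is ONE declaration carried on
THREE docstrings — `ZetaBodyNF` (`a = 0`: `Λ` in the good-`ω` coordinate), `NFPort.HasBKLog` (`b = 0`: along `η_{ω_g}`),
`NFPort.IsCongruenceGenerator` (`c̃_g`) — and must be PORTED TOGETHER (a port changing one of them changes `m` and must swap
`rhs ↦ rhs·‖c̃_g‖_λ^{−m}`).  N4 (row anchors): KLZ17 Thm. 2.7.4 (arXiv:1503.02888 p.12 L46–76, the `Γ₁(N_f)`-Petersson in the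
reciprocity law) and BDV22 (30) (preprint p.30 / journal p.36, carrying `A` to `k_o`) sit next to «KLZ17 Thm. 10.2.2» / «BDV22 Thm. 3.1
(25) p.31» as the anchors of the S1R row.  N5: e10 owned.
e10 (errata, rev 1.1 → 1.2): §A «`γ^± = δ_g^±`» and «IDENTICALLY ABSENT»; §F O3 «`c_g` does NOT occur» (true for the Manin-type
constant `φ_A^*ω_A = c_g ω_g` of a quotient `A`; false as a statement about the CONGRUENCE number `c̃_g`, which occurs in the
class); S2-NF docstring «`γ = δ_g`» (now `γ = γ_g = δ_g/c̃_g`).  NOTHING here proves a summit statement; BSD is proved for no curve.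
-/

noncomputable section

open scoped Classical NumberField TensorProduct BigOperators Pointwise

set_option linter.dupNamespace false

namespace Summit.BirchSwinnertonDyer.BirchSwinnertonDyer.Cruxes.EulerHalfNotRamNoInertSetAtFive.BdvCalibrationSplitNF

open Field
open Literature.NumberTheory.GaloisRepresentations
open Literature.NumberTheory.EllipticCurves Literature.NumberTheory.EllipticCurves.Kato2004
open Literature.NumberTheory.EllipticCurves.Kato2004.EulerSystemValues
open Literature.NumberTheory.EllipticCurves.Rank1Residual
open Literature.NumberTheory.EllipticCurves.Rank1Residual.Typed
open Literature.NumberTheory.EllipticCurves.ModularForms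
open Literature.NumberTheory.EllipticCurves.Castella2018
open Summit.BirchSwinnertonDyer.Rank1Residual
open Summit.BirchSwinnertonDyer.BirchSwinnertonDyer.Theses.ErratumRoadFive
open Summit.BirchSwinnertonDyer.BirchSwinnertonDyer.Theorems
open IsDedekindDomain (HeightOneSpectrum)
open CongruenceSubgroup (Gamma0)
open Rat.HeightOneSpectrum (primesEquiv)

/-! ## §0 Curve side — verbatim copies from deliverable 1 (`Lines/bdv_calibration_split.lean` 32d3c462f2f9, l.162–219,
l.233–297, l.601–656); bodies only, nothing asserted -/

/-! ### §0.1 `bottomClass` (deliverable 1 l.162–169 = bstw_door.lean l.302–305) -/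

/-- The BOTTOM LAYER `z_ℚ ∈ H¹(ℚ, T_pE)` of a class `z₀` of a pinned Iwasawa cohomology.
[cite: Kato2004Asterisque, §12.2 (p. 220) and §14.14 (14.14.1) (p. 243)] -/
def bottomClass (W : WeierstrassCurve ℚ) [W.IsElliptic] (p : ℕ) [Fact p.Prime]
    [ContinuousSMul ℤ_[p] (W.tateModule p)] (K : ZpExtension ℚ p) {γ : absoluteGaloisGroup ℚ}
    (I : IwasawaH1Data W p K γ) (z₀ : I.H) : H1 (tateRep W p) ⊤ :=
  layerZeroToTop W p K (I.proj 0 z₀)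

/-! ### §0.2 The class and the explicit exponent (deliverable 1 l.171–219) -/

/-- The `p`-NON-EXCEPTIONAL RANK-ONE class of [BDV22, §4]: analytic rank `1`, `E[p]` irreducible, and `p` either of
non-split multiplicative reduction or of good ordinary reduction («f is not p-exceptional», [BDV22, p. 7 L16–19 and
p. 35 L24–29]).  The non-split multiplicative members with `p ≠ 2` are exactly `ClassX11b ∧ ¬ split`
(`nonExceptionalRankOneAt_of_classX11b`). [cite: BertoliniDarmonVenerucci2022, §4, p. 35] -/
def NonExceptionalRankOneAt (W : WeierstrassCurve ℚ) [W.IsElliptic] [W.IsGloballyMinimal] (p : ℕ)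
    [Fact p.Prime] : Prop :=
  W.analyticRank = 1 ∧ Irr W p ∧
    ((Mult W p ∧ ¬ W.HasSplitMultiplicativeReductionAtPrime p) ∨ GoodOrd W p)

theorem nonExceptionalRankOneAt_of_classX11b (W : WeierstrassCurve ℚ) [W.IsElliptic] [W.IsGloballyMinimal]
    (p : ℕ) [Fact p.Prime] (hX : ClassX11b W p) (hns : ¬ W.HasSplitMultiplicativeReductionAtPrime p) :
    NonExceptionalRankOneAt W p :=
  ⟨hX.1, hX.2.2.2, Or.inl ⟨hX.2.2.1, hns⟩⟩

/-- The EXPLICIT crossing exponent of the BDV chain (row table in the module docstring):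
`1 − ord_p(p + 1 − a_p) + ord_p c − ord_p s − ord_p k − (ord_p r_f − ord_p m_f) − v_Kato`.
Arguments: `ap = a_p(E)` (`W.LFunction p`), `c` = the Manin constant of the parametrisation (`Dt.c`), `s`, `k` =
the two Gross–Zagier descent scalars, `rf` = congruence number, `m` = (minimal) modular degree, `v` = the Kato-family
normalisation valuation `v(σ) + ord_p(λ/(q·R·∏P_ℓ))`.
[cite: BertoliniDarmonVenerucci2022, §4 (38), p. 44] [cite: BurungaleSkinnerTianWan2024, §6.2.1 (log-Kato-elt-1), p. 60] -/
def bdvExplicitExponent (p : ℕ) (ap c : ℤ) (s : ℚ) (k : ℤ) (rf m : ℕ) (v : ℤ) : ℤ :=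
  1 - padicValInt p ((p : ℤ) + 1 - ap) + padicValInt p c - padicValRat p s - padicValInt p k -
    ((padicValNat p rf : ℤ) - padicValNat p m) - v

/-- At a prime `p ≥ 5` of NON-SPLIT multiplicative reduction `a_p = −1` [KO92, Lemme 1], so `p + 1 − a_p = p + 2`
is prime to `p` and the `a_p`-term of `bdvExplicitExponent` vanishes: the explicit exponent is the registered
`A♭-fam` exponent. [cite: KrausOesterle1992, §3 Lemme 1, p. 262] -/
theorem bdvExplicitExponent_of_not_split (W : WeierstrassCurve ℚ) [W.IsElliptic] (p : ℕ) [Fact p.Prime]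
    (hm : Mult W p) (hns : ¬ W.HasSplitMultiplicativeReductionAtPrime p) (h5 : 5 ≤ p)
    (c : ℤ) (s : ℚ) (k : ℤ) (rf m : ℕ) (v : ℤ) :
    bdvExplicitExponent p (W.LFunction p) c s k rf m v =
      1 + padicValInt p c - padicValRat p s - padicValInt p k - ((padicValNat p rf : ℤ) - padicValNat p m) - v := by
  have ha : W.LFunction p = -1 :=
    KrausOesterle1992.lFunction_apply_prime_eq_neg_one_of_not_split W p hm hns
  have h0 : padicValInt p ((p : ℤ) + 1 - W.LFunction p) = 0 := by
    rw [ha]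
    refine padicValInt.eq_zero_of_not_dvd ?_
    intro hdvd
    have h2 : (p : ℤ) ∣ ((2 : ℕ) : ℤ) := by
      have h' := dvd_sub hdvd (dvd_refl (p : ℤ))
      have e : (p : ℤ) + 1 - -1 - (p : ℤ) = ((2 : ℕ) : ℤ) := by push_cast; ring
      rwa [e] at h'
    have hp2 : p ∣ 2 := Int.natCast_dvd_natCast.mp h2
    have := Nat.le_of_dvd two_pos hp2
    omega
  rw [bdvExplicitExponent, h0]
  ring

/-- **S1R (rev 1.2 §H (H1), pen g52 2026-08-31T03:03:23Z option (α), TOTIENT spelling).**  The amended explicit exponent: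
`bdvExplicitExponent` minus the `Γ₁(N)/Γ₀(N)` Petersson-index valuation `v_p φ(N)` of the LEVEL `N` of the newform `f`
(`= v_p [Γ̄₀(N/p) : Γ̄₁(N/p)]` at `p ∥ N`, `p` odd), written `− (padicValNat p (Nat.totient N) : ℤ)` right after the kept Γ₀ pair.
Source: BDV22 Thm. 3.1 (25) unit `A` = KLZ17's `Γ₁(N_f)`-Petersson (Thm. 2.7.4 p.12 L46–76 / Thm. 10.2.2), carried to `k_o` by BDV22 (30)
(memo `bdv22_o4_erho_level.md` rev 1.4; typer T0′).  ONE tree definition: the LEAD's er5 F1 RDefs (V381 N1); this is a sketch copy.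
[cite: BertoliniDarmonVenerucci2022, Thm. 3.1 (25) p. 31 and (30) p. 36] [cite: KingsLoefflerZerbes2017, Thm. 2.7.4 p. 12 and Thm. 10.2.2 p. 79–80] -/
def bdvExplicitExponentR (p : ℕ) (ap c : ℤ) (s : ℚ) (k : ℤ) (rf m : ℕ) (v : ℤ) (N : ℕ) : ℤ :=
  1 - padicValInt p ((p : ℤ) + 1 - ap) + padicValInt p c - padicValRat p s - padicValInt p k -
    ((padicValNat p rf : ℤ) - padicValNat p m) - (padicValNat p (Nat.totient N) : ℤ) - v

/-- `bdvExplicitExponentR = bdvExplicitExponent − v_p φ(N)` (the S1R sketch's shape `Lines/bdv_explicit_exponent_R_Sketch.lean`). -/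
theorem bdvExplicitExponentR_eq_sub (p : ℕ) (ap c : ℤ) (s : ℚ) (k : ℤ) (rf m : ℕ) (v : ℤ) (N : ℕ) :
    bdvExplicitExponentR p ap c s k rf m v N = bdvExplicitExponent p ap c s k rf m v - padicValNat p (Nat.totient N) := by
  simp only [bdvExplicitExponentR, bdvExplicitExponent]
  ring

/-- On `p ∤ φ(N)` (no bad prime `q ≡ 1 (mod p)`, and `p² ∤ N`) the amendment vanishes: the R exponent IS the rev 1.1 exponent. -/
theorem bdvExplicitExponentR_eq_of_not_dvd_totient (p : ℕ) (ap c : ℤ) (s : ℚ) (k : ℤ) (rf m : ℕ) (v : ℤ) (N : ℕ)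
    (hN : ¬ p ∣ Nat.totient N) :
    bdvExplicitExponentR p ap c s k rf m v N = bdvExplicitExponent p ap c s k rf m v := by
  rw [bdvExplicitExponentR_eq_sub, padicValNat.eq_zero_of_not_dvd hN]
  simp

/-- The non-split specialisation of the R exponent (`a_p = −1`, [KO92, Lemme 1]): the registered `A♭-fam` exponent with the
S1R term. [cite: KrausOesterle1992, §3 Lemme 1, p. 262] -/
theorem bdvExplicitExponentR_of_not_split (W : WeierstrassCurve ℚ) [W.IsElliptic] (p : ℕ) [Fact p.Prime]
    (hm : Mult W p) (hns : ¬ W.HasSplitMultiplicativeReductionAtPrime p) (h5 : 5 ≤ p)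
    (c : ℤ) (s : ℚ) (k : ℤ) (rf m : ℕ) (v : ℤ) (N : ℕ) :
    bdvExplicitExponentR p (W.LFunction p) c s k rf m v N =
      1 + padicValInt p c - padicValRat p s - padicValInt p k - ((padicValNat p rf : ℤ) - padicValNat p m) -
        (padicValNat p (Nat.totient N) : ℤ) - v := by
  rw [bdvExplicitExponentR_eq_sub, bdvExplicitExponent_of_not_split W p hm hns h5]
  ring

/-- The CURVE conjunct of S1 ON THE R EXPONENT at a given shift function `V` (rev 1.2 §H (H1)) = deliverable 1
`BdvChainExplicitNonsplit` l.234–297 with the leading `∃ V : ℕ → ℤ → ℤ,` removed and `bdvExplicitExponent … v` replaced by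
`bdvExplicitExponentR … v N` (`N` the level binder of `f`; verbatim otherwise).  Twin of the LEAD's `BdvChainExplicitNonsplitR`.
[cite: BertoliniDarmonVenerucci2022, §4 (38) and Lemma 4.6, p. 44–45] [cite: KingsLoefflerZerbes2017, Thm. 10.2.2, p. 79–80] -/
def BdvChainCurveConjunctR (V : ℕ → ℤ → ℤ) : Prop :=
    ∀ (W : WeierstrassCurve ℚ) [W.IsElliptic] [W.IsGloballyMinimal] (p : ℕ) [Fact p.Prime]
      [ContinuousSMul ℤ_[p] (W.tateModule p)] [Module.Free ℤ_[p] (W.tateModule p)]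
      [Module.Finite ℤ_[p] (W.tateModule p)] [NeZero (W.conductorNorm ℤ)],
      NonExceptionalRankOneAt W p → 5 ≤ p → Surj W p →
      ∀ (L : Type) [Field L] [NumberField L], IsImaginaryQuadratic L →
        SatisfiesHeegnerHypothesis (W.conductorNorm ℤ) L → SatisfiesHeegnerHypothesis p L →
        NumberField.discr L < -4 → Odd (NumberField.discr L) →
        (W.quadraticTwist (NumberField.discr L : ℚ)).entireLFunction 1 ≠ 0 →
      ∀ (Dt : ModularParametrizationData W (W.conductorNorm ℤ))
        (Hd : HeegnerDatum (W.conductorNorm ℤ) (NumberField.discr L)) (w₀ : NumberField.InfinitePlace L)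
        (PL : (W.baseChange L).toAffine.Point),
        WeierstrassCurve.Affine.Point.map w₀.embedding.toRatAlgHom PL = heegnerPointComplex Dt Hd →
        ¬ (p : ℤ) ∣ Dt.c →
      ∀ (s : ℚ) (k : ℤ),
        (Real.sqrt ((NumberField.discr L).natAbs : ℝ) : ℂ) *
            (W.quadraticTwist (NumberField.discr L : ℚ)).entireLFunction 1 = (s : ℂ) * (minusPeriod Dt.f : ℂ) →
        (Dt.c : ℝ) * minusPeriod Dt.f = k * W.imaginaryPeriodRat →
      ∀ (W' : WeierstrassCurve ℚ) [W'.IsElliptic] (D : ModularParametrizationData W' (W.conductorNorm ℤ)),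
        D.f = Dt.f →
        (∀ (W'' : WeierstrassCurve ℚ) [W''.IsElliptic] (D'' : ModularParametrizationData W'' (W.conductorNorm ℤ)),
            D''.f = D.f → D.modularDegree ≤ D''.modularDegree) →
      ∀ (K : ZpExtension ℚ p) (hK : K.IsCyclotomic) (γ : absoluteGaloisGroup ℚ)
        (I : IwasawaH1Data W p K γ), K.IsTopGenerator γ →
      ∀ (hp : p ≠ 2) (N : ℕ) [NeZero N] (f : CuspForm (Gamma0 N) 2), IsNewformOf W f →
      ∀ (ι : (n : ℕ) → (CyclotomicField n ℚ →+* ℂ)) (q : ℚ)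
        (Λ : ∀ (m : ℕ) (r : Finset (HeightOneSpectrum (𝓞 ℚ))),
          H1 (tateRep W p) (cycSubgroup p m r) →ₗ[ℤ_[p]] ℚ_[p] ⊗[ℚ] CyclotomicField (cycLevel p m r) ℚ)
        (c d₁ a : ℤ) (A : ℕ) (d' : ℤ)
        (z : ∀ (m : ℕ) (r : (cyclotomicLevelsRat p (badPlaces c d₁ A N)).Ideals),
          H1 (tateRep W p) ((cyclotomicLevelsRat p (badPlaces c d₁ A N)).level m r.1))
        (x : ∀ (m : ℕ) (r : (cyclotomicLevelsRat p (badPlaces c d₁ A N)).Ideals),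
          CyclotomicField (cycLevel p m r.1) ℚ)
        (y : I.H) (perRatio : ℚ),
        q ≠ 0 → ZetaBody W p f ι ((q : ℚ) : ℝ) Λ c d₁ a A z x →
        (∀ n : ℕ, I.proj n y =
          levelToLayer W p hK hp (badPlaces c d₁ A N) n
            (z (n + 1) (cyclotomicLevelsRat p (badPlaces c d₁ A N)).idealOne)) →
        0 < A → Int.gcd c (6 * p * A) = 1 → Int.gcd d₁ (6 * p * N) = 1 → (d₁ : ℤ) * d' ≡ 1 [ZMOD (A : ℤ)] →
        ratCuspFactor f true c d₁ a A d' ≠ 0 → perRatio ≠ 0 →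
        plusPeriod f = ((perRatio : ℚ) : ℝ) * W.realPeriodRat →
      ∀ (ι' : PadicAlgCl p ≃+* ℂ)
        (κ : ZpExtension L p) (γ' : absoluteGaloisGroup L) (ΩK : ℂ) (Ωp : (unrIntegers p)ˣ) (Λf : UnrSeries p),
        κ.IsAnticyclotomic → κ.IsTopGenerator γ' → ΩK ≠ 0 →
        IsBDPLFunction ι' (X11b.primeOfEmbeddingDatum p ι' w₀.embedding) κ γ' Dt.f ΩK
          ((Ωp : unrIntegers p) : ℂ_[p]) Λf →
      ∀ (X : ℂ_[p]), Λf.HasValueAt 0 X →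
      ∀ σ : ℚ_[p], HasLocPKummerLog W p (bottomClass W p K I y) σ → σ ≠ 0 →
        ‖X‖ = (p : ℝ) ^ (bdvExplicitExponentR p (W.LFunction p) Dt.c s k (congruenceNumber Dt.f) D.modularDegree
            (σ.valuation + padicValRat p (perRatio /
              (q * ratCuspFactor f true c d₁ a A d' * ∏ ℓ ∈ A.primeFactors.erase p, eulerFactorAtOne W N ℓ))) N -
            V p (NumberField.discr L))

/-- `A♭-fam` ON THE R EXPONENT (rev 1.2 §H (H1)): the registered open stub statement
`BstwDoor.stub_katoBdpCrossingNonsplitFamily` (bstw_door.lean 5666110a8ff7d20b l.782–832) with the ONE S1R amendment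
`− (padicValNat p (Nat.totient N) : ℤ)` after the Γ₀ pair (verbatim otherwise).  Twin of the LEAD's `AFlatFamStatementR`
(d2R P1, decl of record once landed); the pen keys stmt-…-33169 r3 on this shape after P1 + P2.
[cite: Kato2004Asterisque, Thm. 12.5, p. 229] [cite: BurungaleSkinnerTianWan2024, Thm. 1.1, p. 3]
[cite: KingsLoefflerZerbes2017, Thm. 10.2.2, p. 79–80] -/
def AFlatFamStatementR : Prop :=
    ∀ (W : WeierstrassCurve ℚ) [W.IsElliptic] [W.IsGloballyMinimal] (p : ℕ) [Fact p.Prime]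
      [ContinuousSMul ℤ_[p] (W.tateModule p)] [Module.Free ℤ_[p] (W.tateModule p)]
      [Module.Finite ℤ_[p] (W.tateModule p)] [NeZero (W.conductorNorm ℤ)],
      ClassX11b W p → 5 ≤ p → Surj W p → ¬ W.HasSplitMultiplicativeReductionAtPrime p →
      ∀ (L : Type) [Field L] [NumberField L], IsImaginaryQuadratic L →
        SatisfiesHeegnerHypothesis (W.conductorNorm ℤ) L → SatisfiesHeegnerHypothesis p L →
        NumberField.discr L < -4 → Odd (NumberField.discr L) →
        (W.quadraticTwist (NumberField.discr L : ℚ)).entireLFunction 1 ≠ 0 →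
      ∀ (Dt : ModularParametrizationData W (W.conductorNorm ℤ))
        (Hd : HeegnerDatum (W.conductorNorm ℤ) (NumberField.discr L)) (w₀ : NumberField.InfinitePlace L)
        (PL : (W.baseChange L).toAffine.Point),
        WeierstrassCurve.Affine.Point.map w₀.embedding.toRatAlgHom PL = heegnerPointComplex Dt Hd →
        ¬ (p : ℤ) ∣ Dt.c →
      ∀ (s : ℚ) (k : ℤ),
        (Real.sqrt ((NumberField.discr L).natAbs : ℝ) : ℂ) *
            (W.quadraticTwist (NumberField.discr L : ℚ)).entireLFunction 1 = (s : ℂ) * (minusPeriod Dt.f : ℂ) →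
        (Dt.c : ℝ) * minusPeriod Dt.f = k * W.imaginaryPeriodRat →
      ∀ (W' : WeierstrassCurve ℚ) [W'.IsElliptic] (D : ModularParametrizationData W' (W.conductorNorm ℤ)),
        D.f = Dt.f →
        (∀ (W'' : WeierstrassCurve ℚ) [W''.IsElliptic] (D'' : ModularParametrizationData W'' (W.conductorNorm ℤ)),
            D''.f = D.f → D.modularDegree ≤ D''.modularDegree) →
      ∀ (K : ZpExtension ℚ p) (hK : K.IsCyclotomic) (γ : absoluteGaloisGroup ℚ)
        (I : IwasawaH1Data W p K γ), K.IsTopGenerator γ →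
      ∀ (hp : p ≠ 2) (N : ℕ) [NeZero N] (f : CuspForm (Gamma0 N) 2), IsNewformOf W f →
      ∀ (ι : (n : ℕ) → (CyclotomicField n ℚ →+* ℂ)) (q : ℚ)
        (Λ : ∀ (m : ℕ) (r : Finset (HeightOneSpectrum (𝓞 ℚ))),
          H1 (tateRep W p) (cycSubgroup p m r) →ₗ[ℤ_[p]] ℚ_[p] ⊗[ℚ] CyclotomicField (cycLevel p m r) ℚ)
        (c d₁ a : ℤ) (A : ℕ) (d' : ℤ)
        (z : ∀ (m : ℕ) (r : (cyclotomicLevelsRat p (badPlaces c d₁ A N)).Ideals),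
          H1 (tateRep W p) ((cyclotomicLevelsRat p (badPlaces c d₁ A N)).level m r.1))
        (x : ∀ (m : ℕ) (r : (cyclotomicLevelsRat p (badPlaces c d₁ A N)).Ideals),
          CyclotomicField (cycLevel p m r.1) ℚ)
        (y : I.H) (perRatio : ℚ),
        q ≠ 0 → ZetaBody W p f ι ((q : ℚ) : ℝ) Λ c d₁ a A z x →
        (∀ n : ℕ, I.proj n y =
          levelToLayer W p hK hp (badPlaces c d₁ A N) n
            (z (n + 1) (cyclotomicLevelsRat p (badPlaces c d₁ A N)).idealOne)) →
        0 < A → Int.gcd c (6 * p * A) = 1 → Int.gcd d₁ (6 * p * N) = 1 → (d₁ : ℤ) * d' ≡ 1 [ZMOD (A : ℤ)] →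
        ratCuspFactor f true c d₁ a A d' ≠ 0 → perRatio ≠ 0 →
        plusPeriod f = ((perRatio : ℚ) : ℝ) * W.realPeriodRat →
      ∀ (ι' : PadicAlgCl p ≃+* ℂ)
        (κ : ZpExtension L p) (γ' : absoluteGaloisGroup L) (ΩK : ℂ) (Ωp : (unrIntegers p)ˣ) (Λf : UnrSeries p),
        κ.IsAnticyclotomic → κ.IsTopGenerator γ' → ΩK ≠ 0 →
        IsBDPLFunction ι' (X11b.primeOfEmbeddingDatum p ι' w₀.embedding) κ γ' Dt.f ΩK
          ((Ωp : unrIntegers p) : ℂ_[p]) Λf →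
      ∀ (X : ℂ_[p]), Λf.HasValueAt 0 X →
      ∀ σ : ℚ_[p], HasLocPKummerLog W p (bottomClass W p K I y) σ → σ ≠ 0 →
        ‖X‖ = (p : ℝ) ^ (1 + padicValInt p Dt.c - padicValRat p s - padicValInt p k -
            ((padicValNat p (congruenceNumber Dt.f) : ℤ) - padicValNat p D.modularDegree) -
            (padicValNat p (Nat.totient N) : ℤ) -
            (σ.valuation + padicValRat p (perRatio /
              (q * ratCuspFactor f true c d₁ a A d' * ∏ ℓ ∈ A.primeFactors.erase p, eulerFactorAtOne W N ℓ))))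

/-! ## §1 Newform vocabulary: the D-twins (definitions with bodies; one posited interface `NFPort`) -/

section NF

variable (p : ℕ) [Fact p.Prime]

/-- D2e — `P_ℓ(ℓ⁻¹) = 1 − a_ℓ(g)/ℓ + ε(ℓ)/ℓ` for a weight-two form `g` of level `N` (`ε(ℓ) = 0` for `ℓ ∣ N`, else `1`):
the twin of `MemberMultiplierInputs.eulerFactorAtOne W N ℓ` with `a_ℓ(g) = cuspCoeff g ℓ` in place of `W.LFunction ℓ`.
[cite: Kato2004Asterisque, Ex. 13.3 (p. 225), Lemma 13.10 (1) (p. 230)] -/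
def eulerFactorAtOneNF {N : ℕ} (g : CuspForm (Gamma0 N) 2) (M ℓ : ℕ) : ℂ :=
  1 - cuspCoeff g ℓ / ℓ + (if ℓ ∣ M then 0 else (1 : ℂ) / ℓ)

/-- D2c — Kato's four-term auxiliary-cusp factor `R^∓_χ` (Thm. 6.6 (1), Lemma 13.10 (1); parity cross-over as in
`EulerSystemValues.cuspFactor`) for a newform `g` with ARBITRARY coefficients, the symbols read in the period currency
`(Ω⁺, Ω⁻)`: `[r]⁺ := plusSymbol g r / Ω⁺`, `[r]⁻ := minusSymbol g r / Ω⁻` (complex numbers, in `K_g` by Shimura when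
`(Ω⁺, Ω⁻)` are Shimura periods).  Twin of `cuspFactor f` / `ratCuspFactor f` (which use the RATIONAL symbols of a rational
newform). [cite: Kato2004Asterisque, Thm. 6.6 (1) (p. 163), Lemma 13.10 (1) (p. 230)] -/
def cuspFactorNF {N : ℕ} (g : CuspForm (Gamma0 N) 2) (Ωp Ωm : ℂ) (even : Bool) (χbar : ℤ → ℂ) (c d a : ℤ) (A : ℕ)
    (d' : ℤ) : ℂ :=
  let sym : ℚ → ℂ := if even then (fun r ↦ minusSymbol g r / Ωm) else (fun r ↦ plusSymbol g r / Ωp)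
  ((c : ℂ) ^ 2 * (d : ℂ) ^ 2) * sym ((a : ℚ) / A)
    - ((c : ℂ) * (d : ℂ) ^ 2) * χbar c * sym ((a * c : ℚ) / A)
    - ((c : ℂ) ^ 2 * (d : ℂ)) * χbar d * sym ((a * d' : ℚ) / A)
    + ((c : ℂ) * (d : ℂ)) * χbar (c * d) * sym ((a * c * d' : ℚ) / A)

/-- D2p — `(Ω⁺, Ω⁻)` is a pair of **`λ`-OPTIMAL periods** of `g` for the place `λ` induced by `ι′`: both non-zero, every
modular symbol of `g` is `λ`-INTEGRAL in this currency (`‖ι′⁻¹([r]^±)‖ ≤ 1`) and some symbol is a `λ`-UNIT.  This is the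
modular-symbol normalisation of the canonical periods; under `(irr_ℚ)` the Hecke algebra is Gorenstein at `𝔪_λ` and these
are BSTW's optimal periods `Ω^±` up to `O_(λ)^×` [BSTW24 §1.2.4–1.2.9: Rem. 1.1–1.2, Lemma (GorPer); identification with
Vatsal's canonical periods p.16 L102–110].  Twin of `plusPeriod f = perRatio · W.realPeriodRat`, `c Ω⁻_f = k Ω⁻_E`.
[cite: BurungaleSkinnerTianWan2024, §1.2 Rem. 1.1–1.3, p. 14] -/
def IsOptimalPeriodPair {N : ℕ} (g : CuspForm (Gamma0 N) 2) (ι' : PadicAlgCl p ≃+* ℂ) (Ωp Ωm : ℂ) : Prop :=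
  Ωp ≠ 0 ∧ Ωm ≠ 0 ∧
    (∀ r : ℚ, ‖ι'.symm (plusSymbol g r / Ωp)‖ ≤ 1 ∧ ‖ι'.symm (minusSymbol g r / Ωm)‖ ≤ 1) ∧
    (∃ r : ℚ, ‖ι'.symm (plusSymbol g r / Ωp)‖ = 1) ∧ (∃ r : ℚ, ‖ι'.symm (minusSymbol g r / Ωm)‖ = 1)

/-- The evaluation `ℚ̄_p ⊗_ℚ ℚ(ζ_m) → ℂ`, `y ⊗ ζ ↦ ι′(y) · ι_m(ζ)` (plumbing for `charSumNF`). [folklore] -/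
def evalTensor (m : ℕ) [NeZero m] (ι' : PadicAlgCl p ≃+* ℂ) (ιm : CyclotomicField m ℚ →+* ℂ) :
    PadicAlgCl p ⊗[ℚ] CyclotomicField m ℚ →ₐ[ℚ] ℂ :=
  Algebra.TensorProduct.lift (ι'.toRingHom.toRatAlgHom) ιm.toRatAlgHom (fun _ _ ↦ Commute.all _ _)

/-- Kato's character sum `Σ_{b ∈ (ℤ/m)ˣ} χ(b) · (ι′ ⊗ ι_m)((1 ⊗ σ_b) y)` of `y ∈ ℚ̄_p ⊗ ℚ(ζ_m)` — the twin of
`EulerSystemValues.charSum` for coefficient values (left side of Thm. 6.6 (1), p. 163). [folklore] -/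
def charSumNF (m : ℕ) [NeZero m] (ι' : PadicAlgCl p ≃+* ℂ) (ιm : CyclotomicField m ℚ →+* ℂ)
    (χ : DirichletCharacter ℂ m) (y : PadicAlgCl p ⊗[ℚ] CyclotomicField m ℚ) : ℂ :=
  ∑ b : (ZMod m)ˣ, χ (b : ZMod m) *
    evalTensor p m ι' ιm
      (Algebra.TensorProduct.map (AlgHom.id ℚ (PadicAlgCl p))
        (sigma m b : CyclotomicField m ℚ →ₐ[ℚ] CyclotomicField m ℚ) y)

/-- **D2 — `ZetaBodyNF`: the matrix of Kato's Example 13.3 / (8.1.3) for the `ℚ̄_p`-representation `ρ` of a newform `g`**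
— `EulerSystemValues.ZetaBody` transcribed clause by clause with `T := ρ.toGaloisRep` (in the intended use
`IsGaloisRepOfNewform1 (liftToGamma1 N 2 g) ι_λ {ℓ ∣ Np} ρ`) in place of `tateRep W p`, the value datum
`Λ_{k,r} : H¹(ℚ(μ_m), T) → ℚ̄_p ⊗_ℚ ℚ(ζ_m)` (`exp*` read in the coordinate of the GOOD differential `ω_g/c̃_g`, `c̃_g` the
datum's `congrIdx` — rev 1.2 §H pinning `a = 0`: the pinned bottom class is then `κ·𝐳_{γ_g}`, `γ_g = δ_g/c̃_g` BSTW's `O`-basis;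
PORT TOGETHER with `NFPort.HasBKLog` (`b = 0`) and `NFPort.IsCongruenceGenerator` — §H (H5) N3), the complex constant `κ`, the periods
`(Ω⁺, Ω⁻)` as PARAMETERS (pinned by `IsOptimalPeriodPair` in the consumer), classes `z_{k,r}` and values
`x_{k,r} ∈ ℚ̄_p ⊗ ℚ(ζ_m)`: (C1) Euler system on all levels; (C2) unramified away from `p`; (C3a) `Gal(ℚ(μ_m)/ℚ)`-equivariance
of `Λ`; (C3b) `Λ` local at `p`; (C4) `Λ_{k,r}(z_{k,r}) = x_{k,r}` (Kato's rationality `x ∈ K_g(ζ_m)`, Thm. 9.7, is NOT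
re-imposed here — port may add it through `coeffCharField`); (C5) the value law of Thm. 9.7 ∘ Thm. 6.6 (1):
`Σ_b χ(b)(ι′⊗ι_m)(σ_b x_{k,r}) = κ · L_S(g,χ,1)/Ω⁺ · R⁻_χ` (`χ` even), `= −κ · L_S(g,χ,1)/Ω⁻ · R⁺_χ` (`χ` odd; the curve
side's `i·Ω⁻_f` is absorbed in `Ω⁻`).  A PREDICATE (parameters explicit, no `∃`); nothing asserted.
[cite: Kato2004Asterisque, (8.1.3) (p. 180), Prop. 8.12 (p. 186), Thm. 9.7 (p. 189), Thm. 6.6 (1) (p. 163), Thm. 12.5 (p. 229), Ex. 13.3 (pp. 224–225)]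
[cite: Rubin2000, Def. 2.1.1 and Remark 2.1.4] -/
def ZetaBodyNF (ρ : FramedGaloisRep ℚ (PadicAlgCl p) 2) {N : ℕ} (g : CuspForm (Gamma0 N) 2)
    (ι' : PadicAlgCl p ≃+* ℂ) (ι : (m : ℕ) → (CyclotomicField m ℚ →+* ℂ)) (κ Ωp Ωm : ℂ)
    (Λ : ∀ (k : ℕ) (r : Finset (HeightOneSpectrum (𝓞 ℚ))),
      H1 ρ.toGaloisRep (cycSubgroup p k r) →ₗ[PadicAlgCl p]
        PadicAlgCl p ⊗[ℚ] CyclotomicField (cycLevel p k r) ℚ)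
    (c d a : ℤ) (A : ℕ)
    (z : ∀ (k : ℕ) (r : (cyclotomicLevelsRat p (badPlaces c d A N)).Ideals),
      H1 ρ.toGaloisRep ((cyclotomicLevelsRat p (badPlaces c d A N)).level k r.1))
    (x : ∀ (k : ℕ) (r : (cyclotomicLevelsRat p (badPlaces c d A N)).Ideals),
      PadicAlgCl p ⊗[ℚ] CyclotomicField (cycLevel p k r.1) ℚ) : Prop :=
  let T := ρ.toGaloisRep
  let L := cyclotomicLevelsRat p (badPlaces c d A N)
  -- (C1) Euler system, ALL levels
  IsEulerSystem L T p z ∧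
  -- (C2) unramified away from `p`, class level
  (∀ (k : ℕ) (r : L.Ideals) (v : HeightOneSpectrum (𝓞 ℚ)), ((primesEquiv v : Nat.Primes) : ℕ) ≠ p →
      ∀ 𝔓 ∈ v.primesAbove,
        resLe T.toTopRep
            (inf_le_left : L.level k r.1 ⊓ 𝔓.inertia (absoluteGaloisGroup ℚ) ≤ L.level k r.1)
            1 (z k r) = 0) ∧
  -- (C3a) `Gal(ℚ(μ_m)/ℚ)`-equivariance of `Λ`
  (∀ (k : ℕ) (r : Finset (HeightOneSpectrum (𝓞 ℚ))) (σ : absoluteGaloisGroup ℚ)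
      (y : H1 T (cycSubgroup p k r)),
      Λ k r (conjMap T.toTopRep (cycSubgroup p k r) σ 1 y) =
        Algebra.TensorProduct.map (AlgHom.id ℚ (PadicAlgCl p))
          (sigma (cycLevel p k r) (modNCyclotomicCharacter ℚ (cycLevel p k r) σ) :
            CyclotomicField (cycLevel p k r) ℚ →ₐ[ℚ] CyclotomicField (cycLevel p k r) ℚ)
          (Λ k r y)) ∧
  -- (C3b) `Λ` is LOCAL AT `p`
  (∀ (k : ℕ) (r : Finset (HeightOneSpectrum (𝓞 ℚ))) (y : H1 T (cycSubgroup p k r)),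
      (∀ v : HeightOneSpectrum (𝓞 ℚ), ((primesEquiv v : Nat.Primes) : ℕ) = p →
        ∀ 𝔓 ∈ v.primesAbove,
          resLe T.toTopRep
              (inf_le_left : cycSubgroup p k r ⊓ MulAction.stabilizer (absoluteGaloisGroup ℚ) 𝔓 ≤
                cycSubgroup p k r)
              1 y = 0) →
      Λ k r y = 0) ∧
  -- (C4) the declared coordinate
  (∀ (k : ℕ) (r : L.Ideals), Λ k r.1 (z k r) = x k r) ∧
  -- (C5) value law, `S = prime(m·p·A)`, in `(Ω⁺, Ω⁻)`-currency
  (∀ (k : ℕ) (r : L.Ideals) (d' : ℤ) (χ : DirichletCharacter ℂ (cycLevel p k r.1)) (Lχ : ℂ → ℂ),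
      Int.gcd (c * d) (cycLevel p k r.1 * A) = 1 →
      d * d' ≡ 1 [ZMOD (A : ℤ)] →
      IsDepletedTwistedL g (cycLevel p k r.1) (p * A) χ Lχ →
        (χ (-1) = 1 →
          charSumNF p (cycLevel p k r.1) ι' (ι (cycLevel p k r.1)) χ (x k r) =
            κ * (Lχ 1 / Ωp) *
              cuspFactorNF g Ωp Ωm true (fun n ↦ χ⁻¹ (n : ZMod (cycLevel p k r.1))) c d a A d') ∧
        (χ (-1) = -1 →
          charSumNF p (cycLevel p k r.1) ι' (ι (cycLevel p k r.1)) χ (x k r) =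
            -κ * (Lχ 1 / Ωm) *
              cuspFactorNF g Ωp Ωm false (fun n ↦ χ⁻¹ (n : ZMod (cycLevel p k r.1))) c d a A d'))

end NF

/-- **D3 — the posited INTERFACE** (rev 1.2: TWO fields).  `HasBKLog p g ι′ ρ x t` reads «`t ∈ ℚ̄_p` is the Bloch–Kato
logarithm `log_BK^{η_{ω_g}}(loc_𝔭 x)` of the class `x ∈ H¹(F, ρ)` (any level `F = ℚ̄^U`) at the prime `𝔭 ∣ p` of `ℚ̄` fixed by
the frame, ALONG THE FIXED NEWFORM DIFFERENTIAL `ω_g ↔ 2πi·g(z)dz`» exactly as printed in (log-Kato-elt-1) [BSTW24 p.60 L36–44;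
`η_ω`: p.17 L69–70] — rev 1.2 §H pinning `b = 0` (rev 1.1 said «for SOME good `ω`», which is `b = 1`); «along `η`» MEANS the
`η_{ω_g}`-coordinate of `log_BK` modulo `Fil⁰` (≡ `±[log_BK ·, ω_g]`; §H (H5) N2), and the three pinning docstrings (`ZetaBodyNF`, this
field, `IsCongruenceGenerator`) are ONE declaration to be PORTED TOGETHER (§H (H5) N3).
`IsCongruenceGenerator p g ι′ t` reads «`t ∈ ℚ̄_p` generates, over `O_λ`, BSTW's `Γ₁(N)`-congruence ideal of `g`:
`t·O_λ = φ_{Γ₁(N),O}(Ann_𝕋(𝔭_g))·O_λ`» [BSTW24 (congruence), (cong-formula) p.15 L43–56] — the NF chain's OWN INDEX `c̃_g` (§H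
(H2)); the general notion (ARS12 §3) is not in the tree, hence posited like `HasBKLog` [§1.2.10–1.2.12, p. 16–18].  The tree
types this for the Tate module of a curve only (`HasLocPKummerLog`, formal group); for `V_g(1)` it needs `D_dR`/`exp_BK`,
absent today — hence an interface, consumed as a PARAMETER `(P : NFPort)` by every statement below, with the construction
of the intended instance a separate port obligation (never an `instance`, never an axiom).
[cite: BurungaleSkinnerTianWan2024, §1.2.10–1.2.12, p. 16–18] [cite: BlochKato1990, Def. 3.10] -/
structure NFPort where
  /-- «`t = log_BK^{η_{ω_g}}(loc_𝔭 x)` along the FIXED `ω_g`» (rev 1.2; was «for some good `ω`») — see the structure docstring. -/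
  HasBKLog : ∀ (p : ℕ) [Fact p.Prime] {N : ℕ} (_g : CuspForm (Gamma0 N) 2) (_ι' : PadicAlgCl p ≃+* ℂ)
    (ρ : FramedGaloisRep ℚ (PadicAlgCl p) 2) {U : Subgroup (absoluteGaloisGroup ℚ)},
    H1 ρ.toGaloisRep U → PadicAlgCl p → Prop
  /-- «`t·O_λ` is BSTW's `Γ₁(N)`-congruence ideal of `g`» (the NF chain's own index `c̃_g`, rev 1.2 §H (H2)). -/
  IsCongruenceGenerator : ∀ (p : ℕ) [Fact p.Prime] {N : ℕ} (_g : CuspForm (Gamma0 N) 2) (_ι' : PadicAlgCl p ≃+* ℂ),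
    PadicAlgCl p → Prop

/-! ## §2 The S2-NF binder: `NFCalibratorDatum P p L` (calibrator class + value-pinned newform frame) -/

set_option genInjectivity false in
set_option maxHeartbeats 4000000 in
set_option synthInstance.maxHeartbeats 200000 in
/-- **The S2-NF binder list as ONE structure** (the newform twin of the registered frame's binders from `∀ Dt …` on):
a newform `g ∈ S₂(Γ₀(N))` in the CALIBRATOR CLASS at `(L, p)` — `p ∤ 2N`, `λ`-ordinary, `ρ̄` absolutely irreducible,
Heegner for `L` at `N`, `ord_{s=1} L(g,s) = 1`, `L(g ⊗ χ_L, 1) ≠ 0` [BSTW24 §6.2.1 p.59 L101–p.60 L24; Prop. 4.23 p.45] —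
with its `ℚ̄_p`-representation (D1, cited), optimal periods (D2p), a value-pinned Kato family (D2) with guards, the scalar
`s′` (`√|d_L| · L(g ⊗ χ_L,1) = s′ Ω⁻`), a BDP frame and its value `X′` at the trivial character (form-typed tree predicates),
and a Bloch–Kato logarithm `σ′ ≠ 0` of the bottom class (D3 via `P`).
[cite: BurungaleSkinnerTianWan2024, Thm. 6.4 and §6.2.1 (86)–(94), p. 59–60] [cite: Kato2004Asterisque, Thm. 12.5, p. 229] -/
structure NFCalibratorDatum (P : NFPort) (p : ℕ) [Fact p.Prime] (L : Type) [Field L] [NumberField L] where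
  /-- level -/
  N : ℕ
  [neZero : NeZero N]
  /-- the newform -/
  g : CuspForm (Gamma0 N) 2
  newform : IsNewform0 g
  good : ¬ p ∣ 2 * N
  /-- the frame's `ℚ̄_p ≃ ℂ` (fixes `λ ∣ p` and `𝔭 ∣ p`) -/
  ι' : PadicAlgCl p ≃+* ℂ
  /-- D1 (cited) -/
  ρ : FramedGaloisRep ℚ (PadicAlgCl p) 2
  galois : IsGaloisRepOfNewform1 (liftToGamma1 N 2 g)
    (ι'.symm.toRingHom.comp (algebraMap (coeffCharField (liftToGamma1 N 2 g)) ℂ)) {ℓ : ℕ | ℓ ∣ N * p} ρ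
  irr : ρ.IsResiduallyAbsIrreducible
  ordinary : ‖ι'.symm (cuspCoeff g p)‖ = 1
  heegner : SatisfiesHeegnerHypothesis N L
  rankOne : ∃ Λ ∈ completedCuspFormLContinuations N g, analyticOrderNatAt Λ 1 = 1
  /-- `χ_L` (Kronecker character of `L`, pinned on odd `n` by the Jacobi symbol — tree idiom) and `L(g ⊗ χ_L, s)` -/
  χL : DirichletCharacter ℂ (NumberField.discr L).natAbs
  χL_spec : ∀ n : ℕ, Odd n → χL n = (jacobiSym (NumberField.discr L) n : ℂ)
  LχL : ℂ → ℂ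
  LχL_diff : Differentiable ℂ LχL
  LχL_spec : ∀ s : ℂ, 2 < s.re → LχL s = twistedLSeries g χL s
  twist_ne_zero : LχL 1 ≠ 0
  /-- D2p -/
  Ωp : ℂ
  Ωm : ℂ
  optimal : IsOptimalPeriodPair p g ι' Ωp Ωm
  /-- rev 1.2 §H (H2): the NF chain's OWN INDEX — BSTW's `Γ₁(N)`-congruence number `c̃_g` (a generator over `O_λ`), NAMED;
  the value functional `Λ` below reads `exp*` in the coordinate of the good differential `ω_g/c̃_g` (pinning `a = 0`). -/
  congrIdx : PadicAlgCl p
  congrIdx_spec : P.IsCongruenceGenerator p g ι' congrIdx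
  congrIdx_ne : congrIdx ≠ 0
  /-- the Gross–Zagier scalar `s′` -/
  s' : ℂ
  hs' : (Real.sqrt ((NumberField.discr L).natAbs : ℝ) : ℂ) * LχL 1 = s' * Ωm
  /-- D2: the value-pinned Kato family -/
  ι : (n : ℕ) → (CyclotomicField n ℚ →+* ℂ)
  q : ℂ
  hq : q ≠ 0
  Λ : ∀ (m : ℕ) (r : Finset (HeightOneSpectrum (𝓞 ℚ))),
    H1 ρ.toGaloisRep (cycSubgroup p m r) →ₗ[PadicAlgCl p] PadicAlgCl p ⊗[ℚ] CyclotomicField (cycLevel p m r) ℚ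
  c : ℤ
  d₁ : ℤ
  a : ℤ
  A : ℕ
  d' : ℤ
  z : ∀ (m : ℕ) (r : (cyclotomicLevelsRat p (badPlaces c d₁ A N)).Ideals),
    H1 ρ.toGaloisRep ((cyclotomicLevelsRat p (badPlaces c d₁ A N)).level m r.1)
  x : ∀ (m : ℕ) (r : (cyclotomicLevelsRat p (badPlaces c d₁ A N)).Ideals),
    PadicAlgCl p ⊗[ℚ] CyclotomicField (cycLevel p m r.1) ℚ
  zeta : ZetaBodyNF p ρ g ι' ι q Ωp Ωm Λ c d₁ a A z x
  hA : 0 < A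
  hcg : Int.gcd c (6 * p * A) = 1
  hd : Int.gcd d₁ (6 * p * N) = 1
  hdd' : (d₁ : ℤ) * d' ≡ 1 [ZMOD (A : ℤ)]
  hR : cuspFactorNF g Ωp Ωm true (fun _ ↦ 1) c d₁ a A d' ≠ 0
  /-- BDP frame (form-typed tree predicates) -/
  w₀ : NumberField.InfinitePlace L
  κ : ZpExtension L p
  γ' : absoluteGaloisGroup L
  ΩK : ℂ
  Ωpp : (unrIntegers p)ˣ
  Λg : UnrSeries p
  hκ : κ.IsAnticyclotomic
  hγ' : κ.IsTopGenerator γ'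
  hΩK : ΩK ≠ 0
  bdp : IsBDPLFunction ι' (X11b.primeOfEmbeddingDatum p ι' w₀.embedding) κ γ' g ΩK
    ((Ωpp : unrIntegers p) : ℂ_[p]) Λg
  X : ℂ_[p]
  hX : Λg.HasValueAt 0 X
  /-- D3: the Bloch–Kato logarithm of the bottom class `z_{0,∅} ∈ H¹(ℚ, ρ)` -/
  σ : PadicAlgCl p
  hσ : P.HasBKLog p g ι' ρ (z 0 (cyclotomicLevelsRat p (badPlaces c d₁ A N)).idealOne) σ
  hσ0 : σ ≠ 0

namespace NFCalibratorDatum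

variable {P : NFPort} {p : ℕ} [Fact p.Prime] {L : Type} [Field L] [NumberField L]

/-- The right-hand side of the NF crossing identity in NORM FORM (module docstring §A):
`p · ‖p + 1 − a_p(g)‖_λ · ‖s′‖_λ · ‖σ′‖ / ‖q′ · R′ · ∏_{ℓ ∣ A, ℓ ≠ p} E′_ℓ‖_λ` — the twin of
`p ^ bdvExplicitExponent p a_p c s k r_f m_f (v(σ) + ord_p(perRatio/(q R ∏ P_ℓ)))` with `c = k = Γ₀ = 0`, `perRatio = 1`.
EXACT under the rev 1.2 port pinning `(a, b) = (0, 0)` of §H (H2) (class `q′·𝐳_{γ_g}`, log along `η_{ω_g}`): the NF chain's own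
index `c̃_g = D.congrIdx` has multiplicity `m = 0` here; the canonical pinning's right-hand side is `rhsCanonical`.
[cite: BurungaleSkinnerTianWan2024, §6.2.1 (log-Kato-elt-1), p. 60] [cite: BertoliniDarmonVenerucci2022, §4 (38), p. 44] -/
def rhs (D : NFCalibratorDatum P p L) : ℝ :=
  (p : ℝ) * ‖D.ι'.symm ((p : ℂ) + 1 - cuspCoeff D.g p)‖ * ‖D.ι'.symm D.s'‖ * ‖D.σ‖ /
    ‖D.ι'.symm (D.q * cuspFactorNF D.g D.Ωp D.Ωm true (fun _ ↦ 1) D.c D.d₁ D.a D.A D.d' *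
        ∏ ℓ ∈ D.A.primeFactors.erase p, eulerFactorAtOneNF D.g D.N ℓ)‖

/-- The right-hand side under the `c̃`-free CANONICAL pinning `(a, b) = (1, 0)` of §H (H2) (value functional AND logarithm
both along the fixed `ω_g`; pinned class `q′·𝐳_{δ_g} = q′·c̃_g·𝐳_{γ_g}`, multiplicity `m = +1`): `rhs / ‖c̃_g‖_λ`.
[cite: BurungaleSkinnerTianWan2024, Lemma 1.5 (ii) p. 15 and §6.2.1 (log-Kato-elt-1), p. 60] -/
def rhsCanonical (D : NFCalibratorDatum P p L) : ℝ :=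
  D.rhs / ‖D.congrIdx‖

/-- When `λ ∤ c̃_g` (`‖c̃_g‖_λ = 1`; §H (H3)) the two pinnings have the same right-hand side. [folklore] -/
theorem rhsCanonical_eq_rhs_of_norm_eq_one (D : NFCalibratorDatum P p L) (h : ‖D.congrIdx‖ = 1) :
    D.rhsCanonical = D.rhs := by
  rw [rhsCanonical, h, div_one]

/-- In general the two right-hand sides differ exactly by the NF chain's own index: `rhs = ‖c̃_g‖_λ · rhsCanonical`. [folklore] -/
theorem rhs_eq_norm_congrIdx_mul_rhsCanonical (D : NFCalibratorDatum P p L) :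
    D.rhs = ‖D.congrIdx‖ * D.rhsCanonical := by
  rw [rhsCanonical, mul_div_cancel₀ _ (norm_ne_zero_iff.mpr D.congrIdx_ne)]

end NFCalibratorDatum

/-! ## §3 The statements S1-NF, S2-NF and the PROVED recomposition to `A♭-fam` -/

/-- The NEWFORM conjunct of S1 at the shift function `V`: on every calibrator datum at an admissible `(L, p)`, `p ≥ 5`,
the NF crossing identity holds up to the SAME `(p, d_L)`-shift `p^{−V p d_L}` as on the curve side (§D of the module
docstring: BDV's constant is `f`-blind and BDV themselves apply (38) to CM theta series, Lemma 4.6).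
[cite: BertoliniDarmonVenerucci2022, §4.6 (38) L13–15 and Lemma 4.6, p. 44–45] -/
def BdvChainNFConjunct (P : NFPort) (V : ℕ → ℤ → ℤ) : Prop :=
  ∀ (p : ℕ) [Fact p.Prime], 5 ≤ p → ∀ (L : Type) [Field L] [NumberField L],
    IsImaginaryQuadratic L → SatisfiesHeegnerHypothesis p L → NumberField.discr L < -4 → Odd (NumberField.discr L) →
    ∀ D : NFCalibratorDatum P p L, ‖D.X‖ = (p : ℝ) ^ (-(V p (NumberField.discr L))) * D.rhs

/-- **S1-NF — `BdvChainExplicitNFR P`: BDV22 (38) valued up to its `(K,p)`-constant, over curves AND newform calibrators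
with ONE shift function `V`** (= deliverable 1's `BdvChainExplicitNonsplit` body ∧ `BdvChainNFConjunct`, same `V`).
Why it might fail (critic V361 C1 — this is WHERE THE LINE'S CONTENT SITS): BDV state (38) «up to multiplication by a
non-zero explicit scalar in the number field `K(a_n(f_α); n ≥ 1)`» [p.44 L19–21] — `f`-DEPENDENT a priori; «one `V`» asserts
that the `λ`-adic VALUATION of that scalar is the same function of `(p, d_L)` at the `p`-NEW multiplicative non-split member
(`p ∥ N`, `a_p = −1`, frozen `β`; no integral Thm. 3.1 in print) and at GOOD-ordinary CM members `g_ψ` of OTHER Hida families;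
the `(1 − 1/α)²`-type factors are units at `α = −1`, `p` odd, but the `Γ`- and period-normalisation part of the scalar across
families is the unverified piece (cheapest falsifier T0 of the memo: transcribe the scalar for both members and compare
`λ`-valuations).  Kato's reciprocity (ERLIint) and BDP themselves are newform-level and add nothing newform-specific.
[cite: BertoliniDarmonVenerucci2022, §4 (38) p. 44 L19–21 and Lemma 4.6, p. 44–45]
[cite: BurungaleSkinnerTianWan2024, Prop. (ERLIint) and §6.2.1, p. 60] -/
def BdvChainExplicitNFR (P : NFPort) : Prop :=
  ∃ V : ℕ → ℤ → ℤ, BdvChainCurveConjunctR V ∧ BdvChainNFConjunct P V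

/-- **S2-NF — `EisensteinPeriodRatioValuationNF P L p`: a NEWFORM calibrator exists at `(L, p)`** — some datum of the
calibrator class carries a non-zero BDP value on which the NF crossing identity holds EXACTLY (norm form, §A).  Supply is
THEOREM-shaped [BSTW24 Prop. 4.23 p.45 L48–64, §8.2 p.66 L43–66, Lemma 8.2; Rohrlich 1984]: CM newforms `g_ψ`; the identity
is BSTW Thm. 6.4's proof, §6.2.1 (86)–(94) with `u_L ∈ ℤ_(p)^×` (p.60 L86–96).  Why it might fail: only through the port —
D3 must be realised by the genuine Bloch–Kato logarithm and (C5)'s normalisation must match BSTW's `O`-basis `γ = γ_g = δ_g/c̃_g` — rev 1.2 §H pinning, rev 1.1 wrote «`δ_g`» (the `q′ R′ ∏E′`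
correction is carried explicitly in `rhs`). [cite: BurungaleSkinnerTianWan2024, Thm. 6.4, §6.2.1 (86)–(94) p. 60, Prop. 4.23 p. 45, Lemma 8.2 p. 66] -/
def EisensteinPeriodRatioValuationNF (P : NFPort) (L : Type) [Field L] [NumberField L] (p : ℕ) [Fact p.Prime] : Prop :=
  ∃ D : NFCalibratorDatum P p L, D.X ≠ 0 ∧ ‖D.X‖ = D.rhs

/-- **The proved recomposition over S2-NF (gate (i) shape of deliverable 1, newform calibrator).**  Conclusion =
`AFlatFamStatementR` (= registered stub statement, token for token).  Proof: S2-NF at `(L, p)` yields a datum with `X′ ≠ 0`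
and exact identity; S1-NF's newform conjunct at the same datum yields the identity shifted by `p^{−V p d_L}`; hence
`p^{−V p d_L} = 1`, `V p d_L = 0` (`zpow` injective, `p > 1`); S1-NF's curve conjunct at the target (a class member by
`nonExceptionalRankOneAt_of_classX11b`) with `V p d_L = 0` and `bdvExplicitExponentR_of_not_split` is the registered exponent with the S1R term (R). -/
theorem aFlatFamR_of_bdvChainNFR_of_calibrationNF (P : NFPort) (h₁ : BdvChainExplicitNFR P)
    (h₂ : ∀ (p : ℕ) [Fact p.Prime], 5 ≤ p → ∀ (L : Type) [Field L] [NumberField L],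
      IsImaginaryQuadratic L → SatisfiesHeegnerHypothesis p L → NumberField.discr L < -4 →
      Odd (NumberField.discr L) → EisensteinPeriodRatioValuationNF P L p) :
    AFlatFamStatementR := by
  intro W _ _ p _ _ _ _ _ hX h5 hS hns L _ _ hLq hH hHp hd4 hodd hLt Dt Hd w₀ PL hPL hc s k hs hk W' _ D hDf hmin
    K hK γ I hγ hp N _ f hf ι q Λ c d₁ a A d' z x y perRatio hq hzeta hy hA hcg hd hdd' hR hper0 hper
    ι' κ γ' ΩK Ωp Λf hκ hγ' hΩK hBDP X hXv σ hσ hσ0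
  obtain ⟨V, hVcurve, hVnf⟩ := h₁
  have hp1 : (1 : ℝ) < p := by exact_mod_cast (Fact.out : p.Prime).one_lt
  have hp0 : (0 : ℝ) < p := lt_trans one_pos hp1
  -- Step 1: the newform calibrator at `(L, p)` pins `V p d_L = 0`.
  have hV0 : V p (NumberField.discr L) = 0 := by
    obtain ⟨D₁, hX0, hD⟩ := h₂ p h5 L hLq hHp hd4 hodd
    have h := hVnf p h5 L hLq hHp hd4 hodd D₁
    have hr : D₁.rhs ≠ 0 := by
      rw [← hD]
      exact norm_ne_zero_iff.mpr hX0
    rw [hD] at h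
    have h1 : (p : ℝ) ^ (-(V p (NumberField.discr L))) = (p : ℝ) ^ (0 : ℤ) := by
      rw [zpow_zero]
      have h' : (p : ℝ) ^ (-(V p (NumberField.discr L))) * D₁.rhs = 1 * D₁.rhs := by
        rw [one_mul]; exact h.symm
      exact mul_right_cancel₀ hr h'
    have he := zpow_right_injective₀ hp0 hp1.ne' h1
    omega
  -- Step 2: S1's curve conjunct at the target curve, with `V p d_L = 0` and `a_p = −1`.
  have h := hVcurve W p (nonExceptionalRankOneAt_of_classX11b W p hX hns) h5 hS L hLq hH hHp hd4 hodd hLt Dt Hd w₀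
    PL hPL hc s k hs hk W' D hDf hmin K hK γ I hγ hp N f hf ι q Λ c d₁ a A d' z x y perRatio hq hzeta hy hA hcg
    hd hdd' hR hper0 hper ι' κ γ' ΩK Ωp Λf hκ hγ' hΩK hBDP X hXv σ hσ hσ0
  rw [hV0, sub_zero, bdvExplicitExponentR_of_not_split W p hX.2.2.1 hns h5] at h
  exact h

/-! ## §4 The finer split of S2-NF — SUPPLY (theorem-shaped in print) · REALISABILITY (port) · BSTW (print) -/

/-- **S2a-NF — `CalibratorSupplyNF L p`: the calibrator CLASS is non-empty at `(L, p)`** — a newform `g ∈ S₂(Γ₀(N))`,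
`p ∤ 2N`, with `ℚ̄_p`-representation `ρ` attached via `ι′`, `ρ̄` absolutely irreducible, `λ`-ordinary, Heegner for `L` at
`N`, of analytic rank one, with `L(g ⊗ χ_L, 1) ≠ 0`.  THEOREM-shaped: BSTW's auxiliary CM family `𝔛` [Prop. 4.23 p.45
L48–64; §8.2 (i)–(viii) p.66 L43–66; Lemma 8.2 p.66 L67–p.67] with Rohrlich's non-vanishing [Ro84, p. 551] supplies CM
newforms `g_ψ` in the class (the curve-shaped `CalibratorSupply` of deliverable 1 is OPEN in print — this is the point of
(b′)).  Why it might fail: transcription risk only — THEOREM-shaped modulo D1 (existence of `ρ`, a cite) and modulo matching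
𝔛's conditions to these clauses (critic V361 C2): `ε(g_ψ) = −1` is 𝔛 (vi) [p.66 L56]; `λ`-ordinarity from 𝔛 (i) «`p` splits in
`K`» (the CM field) via Cor. 6.6; Heegner for `L` from 𝔛 (vii) «every prime dividing `D_K N(𝔣_ψ)` splits in `L`»; analytic rank
one = 𝔛 (viii); `ρ̄_{g_ψ} = Ind ψ̄` absolutely irreducible and the remaining local conditions are BSTW's §7 hypotheses
(A-psi-res), (A-split), (A-good) of Thm. 7.1 [p.64 L49] — the typer states the exact clause used (our materialisation lacks
pp. 61–63 where they are spelled out); the twist branch `L(g_ψ ⊗ χ_L, 1) ≠ 0` is Prop. 4.23's second Rohrlich application,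
not among (i)–(viii) [R2 memo; critic A214]. [cite: BurungaleSkinnerTianWan2024, Prop. 4.23 p. 45, §8.2 and Lemma 8.2 p. 66–67]
[cite: Rohrlich1984, p. 551] -/
def CalibratorSupplyNF (L : Type) [Field L] [NumberField L] (p : ℕ) [Fact p.Prime] : Prop :=
  ∃ (N : ℕ) (_ : NeZero N) (g : CuspForm (Gamma0 N) 2) (ι' : PadicAlgCl p ≃+* ℂ)
    (ρ : FramedGaloisRep ℚ (PadicAlgCl p) 2),
    IsNewform0 g ∧ ¬ p ∣ 2 * N ∧
    IsGaloisRepOfNewform1 (liftToGamma1 N 2 g)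
      (ι'.symm.toRingHom.comp (algebraMap (coeffCharField (liftToGamma1 N 2 g)) ℂ)) {ℓ : ℕ | ℓ ∣ N * p} ρ ∧
    ρ.IsResiduallyAbsIrreducible ∧ ‖ι'.symm (cuspCoeff g p)‖ = 1 ∧
    SatisfiesHeegnerHypothesis N L ∧
    (∃ Λ ∈ completedCuspFormLContinuations N g, analyticOrderNatAt Λ 1 = 1) ∧
    ∃ (χL : DirichletCharacter ℂ (NumberField.discr L).natAbs) (LχL : ℂ → ℂ),
      (∀ n : ℕ, Odd n → χL n = (jacobiSym (NumberField.discr L) n : ℂ)) ∧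
      Differentiable ℂ LχL ∧ (∀ s : ℂ, 2 < s.re → LχL s = twistedLSeries g χL s) ∧ LχL 1 ≠ 0

/-- **S2b-NF — `CalibratorDataRealisableNF P`: every member of the calibrator class at an admissible `(L, p)`, `p ≥ 5`,
carries a full datum with non-zero BDP value** (optimal periods exist; Kato 2004 Thm. 12.5 for `g` with (8.1.3)/Prop. 8.12/
Thm. 9.7/Thm. 6.6 (1); BDP/Castella–Hsieh `IsBDPLFunction` for `g`; the Bloch–Kato logarithm of the bottom class exists
(realisation of `P`) and is non-zero in analytic rank one [BSTW24 weak (PR), §6.2.1 p.60 L25–27]; `X′ ≠ 0` likewise by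
(GRL=logheegner) + Gross–Zagier).  PORT-shaped: content exactly when `P` is the intended interface.
[cite: Kato2004Asterisque, Thm. 12.5, p. 229] [cite: BurungaleSkinnerTianWan2024, §6.2.1, p. 60] -/
def CalibratorDataRealisableNF (P : NFPort) : Prop :=
  ∀ (p : ℕ) [Fact p.Prime], 5 ≤ p → ∀ (L : Type) [Field L] [NumberField L],
    IsImaginaryQuadratic L → SatisfiesHeegnerHypothesis p L → NumberField.discr L < -4 → Odd (NumberField.discr L) →
    CalibratorSupplyNF L p → ∃ D : NFCalibratorDatum P p L, D.X ≠ 0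

/-- **S2c-NF — `BstwIntegralPerrinRiouNF P`: BSTW's integral Perrin-Riou formula at newform level, in norm form** — on
every calibrator datum the NF crossing identity holds exactly [BSTW24 Thm. 6.4, proof §6.2.1: (comp-with-Kato) p.60 L1–6,
(GRL=logheegner)(i) L8–12, (log-Kato-elt-1) L17–24, `u_L ∈ ℤ_(p)^×` L86–96; `c(ω,γ,γ′) ∈ O^×` Prop. (ERLIint);
`‖𝔤(χ_L)‖_λ = 1`].  PRINT-shaped; every hypothesis used is newform-level (kill criterion of (622) not triggered).
[cite: BurungaleSkinnerTianWan2024, Thm. 6.4 and §6.2.1 (86)–(94), p. 59–60] -/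
def BstwIntegralPerrinRiouNF (P : NFPort) : Prop :=
  ∀ (p : ℕ) [Fact p.Prime], 5 ≤ p → ∀ (L : Type) [Field L] [NumberField L],
    IsImaginaryQuadratic L → SatisfiesHeegnerHypothesis p L → NumberField.discr L < -4 → Odd (NumberField.discr L) →
    ∀ D : NFCalibratorDatum P p L, ‖D.X‖ = D.rhs

/-- The finer split recomposes (proved): SUPPLY ∧ REALISABILITY ∧ BSTW ⟹ S2-NF at every admissible `(L, p)`, `p ≥ 5`. -/
theorem eisensteinPeriodRatioValuationNF_of_supply_of_port (P : NFPort)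
    (hsup : ∀ (p : ℕ) [Fact p.Prime], 5 ≤ p → ∀ (L : Type) [Field L] [NumberField L],
      IsImaginaryQuadratic L → SatisfiesHeegnerHypothesis p L → NumberField.discr L < -4 →
      Odd (NumberField.discr L) → CalibratorSupplyNF L p)
    (hreal : CalibratorDataRealisableNF P) (hbstw : BstwIntegralPerrinRiouNF P) :
    ∀ (p : ℕ) [Fact p.Prime], 5 ≤ p → ∀ (L : Type) [Field L] [NumberField L],
      IsImaginaryQuadratic L → SatisfiesHeegnerHypothesis p L → NumberField.discr L < -4 →
      Odd (NumberField.discr L) → EisensteinPeriodRatioValuationNF P L p := by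
  intro p _ h5 L _ _ hLq hHp hd4 hodd
  obtain ⟨D, hX0⟩ := hreal p h5 L hLq hHp hd4 hodd (hsup p h5 L hLq hHp hd4 hodd)
  exact ⟨D, hX0, hbstw p h5 L hLq hHp hd4 hodd D⟩

/-- Corollary: the three print/port pieces and S1-NF give `A♭-fam` (the shape pen g51 re-keys 33169 r2 by import). -/
theorem aFlatFamR_of_bdvChainNFR_of_supply_of_port (P : NFPort) (h₁ : BdvChainExplicitNFR P)
    (hsup : ∀ (p : ℕ) [Fact p.Prime], 5 ≤ p → ∀ (L : Type) [Field L] [NumberField L],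
      IsImaginaryQuadratic L → SatisfiesHeegnerHypothesis p L → NumberField.discr L < -4 →
      Odd (NumberField.discr L) → CalibratorSupplyNF L p)
    (hreal : CalibratorDataRealisableNF P) (hbstw : BstwIntegralPerrinRiouNF P) : AFlatFamStatementR :=
  aFlatFamR_of_bdvChainNFR_of_calibrationNF P h₁ (eisensteinPeriodRatioValuationNF_of_supply_of_port P hsup hreal hbstw)

/-- Sanity: S2-NF is MONOTONE in nothing hidden — with the exact BSTW piece, S1-NF's newform conjunct forces the shift to
vanish wherever a calibrator datum with `X′ ≠ 0` exists (the content of Step 1, isolated). -/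
theorem shift_eq_zero_of_datum (P : NFPort) (V : ℕ → ℤ → ℤ) (hV : BdvChainNFConjunct P V)
    (hbstw : BstwIntegralPerrinRiouNF P) (p : ℕ) [Fact p.Prime] (h5 : 5 ≤ p) (L : Type) [Field L] [NumberField L]
    (hLq : IsImaginaryQuadratic L) (hHp : SatisfiesHeegnerHypothesis p L) (hd4 : NumberField.discr L < -4)
    (hodd : Odd (NumberField.discr L)) (D : NFCalibratorDatum P p L) (hX0 : D.X ≠ 0) :
    V p (NumberField.discr L) = 0 := by
  have hp1 : (1 : ℝ) < p := by exact_mod_cast (Fact.out : p.Prime).one_lt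
  have hp0 : (0 : ℝ) < p := lt_trans one_pos hp1
  have hD := hbstw p h5 L hLq hHp hd4 hodd D
  have h := hV p h5 L hLq hHp hd4 hodd D
  have hr : D.rhs ≠ 0 := by
    rw [← hD]
    exact norm_ne_zero_iff.mpr hX0
  rw [hD] at h
  have h1 : (p : ℝ) ^ (-(V p (NumberField.discr L))) = (p : ℝ) ^ (0 : ℤ) := by
    rw [zpow_zero]
    have h' : (p : ℝ) ^ (-(V p (NumberField.discr L))) * D.rhs = 1 * D.rhs := by
      rw [one_mul]; exact h.symm
    exact mul_right_cancel₀ hr h'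
  have he := zpow_right_injective₀ hp0 hp1.ne' h1
  omega

/-! ## §5 Registrable single-`P` texts (critic V361 P-NF1: ONE `P : NFPort` shared by S1-NF and S2-NF, `∃`-bundled) -/

/-- **`BdvCalibrationNFR` — the registrable two-piece text**: SOME port `P` carries both S1-NF and the S2-NF family (one `P`,
one `V`).  With the junk port `P₀ = ⊤` the S1-NF conjunct is refutable modulo supply, so the `∃ P` cannot be witnessed by junk
once two calibrator data with different `‖σ‖` exist; with the intended `P` it is S1-NF ∧ S2-NF.  (Pinning `P` to the
constructed Bloch–Kato predicate, when the tree has it, is the stronger registrable form.)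
[cite: BertoliniDarmonVenerucci2022, §4 (38) and Lemma 4.6, p. 44–45] [cite: BurungaleSkinnerTianWan2024, Thm. 6.4 and §6.2.1, p. 59–60] -/
def BdvCalibrationNFR : Prop :=
  ∃ P : NFPort, BdvChainExplicitNFR P ∧
    ∀ (p : ℕ) [Fact p.Prime], 5 ≤ p → ∀ (L : Type) [Field L] [NumberField L],
      IsImaginaryQuadratic L → SatisfiesHeegnerHypothesis p L → NumberField.discr L < -4 →
      Odd (NumberField.discr L) → EisensteinPeriodRatioValuationNF P L p

/-- Glue for the two-piece registrable text (proved). -/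
theorem aFlatFamR_of_bdvCalibrationNFR (h : BdvCalibrationNFR) : AFlatFamStatementR := by
  obtain ⟨P, h₁, h₂⟩ := h
  exact aFlatFamR_of_bdvChainNFR_of_calibrationNF P h₁ h₂

/-- **`BdvCalibrationPiecesNFR` — the registrable four-piece text**: the `P`-free SUPPLY (theorem-shaped in print) and SOME
port `P` carrying S1-NF, REALISABILITY and BSTW's exact identity (one `P` for all three).
[cite: BurungaleSkinnerTianWan2024, Prop. 4.23 p. 45, Lemma 8.2 p. 66, Thm. 6.4 p. 59] [cite: Kato2004Asterisque, Thm. 12.5, p. 229] -/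
def BdvCalibrationPiecesNFR : Prop :=
  (∀ (p : ℕ) [Fact p.Prime], 5 ≤ p → ∀ (L : Type) [Field L] [NumberField L],
      IsImaginaryQuadratic L → SatisfiesHeegnerHypothesis p L → NumberField.discr L < -4 →
      Odd (NumberField.discr L) → CalibratorSupplyNF L p) ∧
    ∃ P : NFPort, BdvChainExplicitNFR P ∧ CalibratorDataRealisableNF P ∧ BstwIntegralPerrinRiouNF P

/-- Glue for the four-piece registrable text (proved). -/
theorem aFlatFamR_of_bdvCalibrationPiecesNFR (h : BdvCalibrationPiecesNFR) : AFlatFamStatementR := by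
  obtain ⟨hsup, P, h₁, hreal, hbstw⟩ := h
  exact aFlatFamR_of_bdvChainNFR_of_supply_of_port P h₁ hsup hreal hbstw

/-- Polarity witness for P-NF1 (proved): over the JUNK port every `S2-NF`-type existence claim reduces to the bare existence
of a datum with `X ≠ 0` and the norm identity — i.e. the port field carries no constraint; this is why items are registered
`∃ P`-bundled with S1-NF (whose NF conjunct is an identity over ALL data and is refutable for junk `P`). -/
def junkPort : NFPort := ⟨by intros; exact True, by intros; exact True⟩

theorem junkPort_hasBKLog_trivial (p : ℕ) [Fact p.Prime] {N : ℕ} (g : CuspForm (Gamma0 N) 2)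
    (ι' : PadicAlgCl p ≃+* ℂ) (ρ : FramedGaloisRep ℚ (PadicAlgCl p) 2) {U : Subgroup (absoluteGaloisGroup ℚ)}
    (x : H1 ρ.toGaloisRep U) (t : PadicAlgCl p) : junkPort.HasBKLog p g ι' ρ x t := by
  trivial

end Summit.BirchSwinnertonDyer.BirchSwinnertonDyer.Cruxes.EulerHalfNotRamNoInertSetAtFive.BdvCalibrationSplitNF

end
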